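import Literature.NumberTheory.EllipticCurves.KrizLi2019.SexticTwistBSDThreeDescent
import Literature.NumberTheory.EllipticCurves.Rank1Residual.X12CubeSumTransport
import Literature.NumberTheory.QuadraticFields.FundamentalDiscriminant
import HarnessLib

/-!
# X12 at `p = 3`, Kriz–Li sextic-twist corner: the LANE TRANSPORTS for the seven census classes 225a, 1323m, 1728a, 3888t, 7803b, 11907s, 15129a

HONEST FRAMING (cell `b2b-bsdres`, run/shared/lean/b2b/bsd-rank1-residual/; harvest seat
`b2b-bsdres-harvest-2`, gen 3): prove what is provable now; shrink each hard class to its core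
with data; no claim beyond stated classes. The cell deletes the COMBINATION-SHAPED residual
classes of the BSD formula in analytic rank `≤ 1` from PUBLISHED theorems only and TYPES the
construction-shaped ones; this is not "finishing BSD". Class X12 (CM, rank `1`, `p ∣ 6·d_K·N`,
`p` not split) stays CONSTRUCTION-SHAPED; this file is PER CURVE. Theorems only: no notion
defined, NO new named fact (net debt `0`); the `def`s below are explicit Weierstrass equations
and three explicit changes of variables (data).

The companion file `KrizLi2019/SexticTwistBSDThreeDescent` proves the `ℚ`-consumer
`KrizLi2019.bsdp_three_of_thm1010` of Kriz–Li, Forum Math. Sigma 7 (2019) Thm. 1.23 = 10.10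
(tree fact `KrizLi2019.thm1010_bsdThree_overK_sexticTwist`): for `W ≅ E_d : y² = x³ − 432d`
globally minimal of conductor `N` with `r_an(E_d) = 1`, an imaginary quadratic `K` Heegner for
`3d` and `N`, Kriz–Li's hypotheses (1)–(4), the Heegner point `P_d`, a globally minimal model
`Wd` of the twist `E_d^{(d_K)}` and three side conditions, `rank E_d(ℚ) = 1 ∧ BSD(E_d, 3)`
(from Gross–Zagier, Kolyvagin, Burungale–Flach 2024 and modularity). The census records of the
seven classes concerned (harvest-2's `KL19-X12-SEXTIC.md` §3) are Cremona's curves `…1`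
(`y² (+ y) = x³ + a` with `64a + 16 = 16·d`, resp. `a = 16d/2⁶`), which are `3`-isogenous to
`E_d = …2`. Following the template of `Rank1Residual/X12CubeSumTransport` (harvest-1 gen 3,
referee R65.3/R69.2) this file supplies, IN THE KERNEL:

* the fourteen Cremona equations `…1`, `…2` and, for ONE admissible `K = ℚ(√d_K)` per class
  (`d_K = −11, −47, −23, −23, −8, −47, −8`), the globally minimal model `…2Tw` of the quadratic
  twist `E_d^{(d_K)}`, all with `IsElliptic` / `IsGloballyMinimal` INSTANCES decided in the kernel
  (`X12CubeSum.isGloballyMinimal_mk`: `3`-adic criterion at `3`, `ord_q Δ < 12` elsewhere); the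
  fields `K` are chosen among the admissible ones so that the twist's minimal model has
  `ord₂ Δ < 12` (for `d_K = −20` the minimal twists of 1323m2 and 11907s2 have `ord₂ Δ = 12`,
  outside Silverman's criterion);
* the identifications `…2 ≅ ⟨0,0,0,0,−432d⟩` and `Cd • (…2)^{(d_K)} = …2Tw` by explicit changes
  of variables (`HuShuYin2019.halfScale`, `scaleHalf`, `shiftHalfT`, `scaleTwo`), with
  `ord₃ u(Cd) = 0` — side condition (ii) of the consumer DISCHARGED;
* Kriz–Li's hypotheses (1) (`d` fundamental) and (2) (`d mod 9`) by `decide`/`norm_num`;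
* the `3`-isogenies `…1 ~ …2` (`X12CubeSum.isIsogenous_of_a₆`, resp. Vélu `isIsogenous_mk_a₆`);
* `r_an = 1 ∧ BSD(E, 3)` for the seven census records `…1`, transported along the isogeny
  (Cassels, `X12CubeSum.bsdp_three_of_isIsogenous`; `Ш(…2)` finite from Kolyvagin over `K`).

What REMAINS as explicit hypotheses of each record theorem (nothing is hidden in an instance):
(a) the published named facts (Kriz–Li Thm. 10.10, Gross–Zagier = `gross_zagier`, Kolyvagin =
`kolyvagin`, Burungale–Flach 2024 Cor. 2, modularity, Cassels); (b) the Gross–Zagier data of the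
pair — an imaginary quadratic `K` with `d_K` as chosen, the Heegner hypotheses for `3|d|` and `N`,
a parametrisation datum `Dt` of `…2` at level `N` with `3 ∤` its Manin constant (hypothesis (4);
Cremona's `opt_man`: Manin constant `1` for both curves of each class), the Heegner point `P`;
(c) the ARITHMETIC inputs the tree cannot evaluate today, certified outside the kernel by two
engines (harvest-2 `kl/kl_check.py`, `kl/kl_second.gp` j064965, `kl/kl_cert.gp` j067614):
the conductor `N(…2) = N`, the two `3`-class-number conditions of hypothesis (3) for the chosen
`K`, side condition (i) `ord₃ Tam(…2Tw) = ord₃ Tam(…2)` (engine values: equal in 7/7), side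
condition (iii) `3 ∤ #μ(K)` (`d_K ∉ {−3, −4}`); (d) the census datum `r_an(…1) = 1`.
The theorems are about the explicit equations; that `[0,0,1,0,1]` is the curve Cremona calls
225a1 is the table read (`allcurves`), checked outside the kernel.
§7–§8 (appended): side condition (iii) is DISCHARGED — a quadratic field with `3 ∣ #μ(K)` has
`d_K = −3` (`discr_eq_neg_three_of_three_dvd_torsionOrder`), so the primed record theorems
`bsdp_three_cremona<N>'` drop the `#μ(K)` hypothesis (`d_K ∈ {−11, −47, −23, −8}` here).

## References
* [KrizLi2019] D. Kriz, C. Li, Forum Math. Sigma 7 (2019) e15, Thm. 1.23 = Thm. 10.10, Cor. 10.7.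
* [Cremona1997] J. E. Cremona, *Algorithms for Modular Elliptic Curves*, 2nd ed., Table 1 and
  `ecdata/allcurves` (classes 225a, 1323m, 1728a (4 curves), 3888t, 7803b, 11907s, 15129a).
* [SilvermanAEC2009] VII.1 Remark 1.1, VIII.8, III.1, X.5 Prop. 5.4.
* [GrossZagier1986] I.(6.3); [CaiShuTian2014] Thm. 1.1; [Kolyvagin1990] Thm. A;
  [BurungaleFlach2024] Cor. 2; [MilneADT2006] Thm. I.7.3 (Cassels); [Miller2011LMS] Def. 1.1.
* HOME/b2b-bsdres-harvest-2/KL19-X12-SEXTIC.md §3 (reach table), §7 (certificates);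
  HOME/REFEREE.md R65.3, R69.2.
-/

set_option autoImplicit false

noncomputable section

open scoped Classical

open WeierstrassCurve NumberField Literature.NumberTheory.EllipticCurves
  Literature.NumberTheory.EllipticCurves.ModularForms
  Literature.NumberTheory.EllipticCurves.HuShuYin2019
  Literature.NumberTheory.EllipticCurves.Rank1Residual.X12CubeSum
  Literature.NumberTheory.EllipticCurves.KrizLi2019

namespace Literature.NumberTheory.EllipticCurves.Rank1Residual.X12SexticTwist

/-! ### §1. Changes of variables and the shape of the twists -/

/-- The scaling `u = 1/2` (`r = s = t = 0`): `y² = x³ + a ↦ y² = x³ + 64a`. [folklore] -/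
def scaleHalf : VariableChange ℚ :=
  ⟨⟨(1 / 2 : ℚ), 2, by norm_num, by norm_num⟩, 0, 0, 0⟩

/-- The scaling `u = 2`: `y² = x³ + a ↦ y² = x³ + a/64`. [folklore] -/
def scaleTwo : VariableChange ℚ :=
  ⟨⟨(2 : ℚ), 1 / 2, by norm_num, by norm_num⟩, 0, 0, 0⟩

/-- The shift `t = 1/2` (`u = 1`, `r = s = 0`): `y² = x³ + a ↦ y² + y = x³ + (a − 1/4)`.
[folklore] -/
def shiftHalfT : VariableChange ℚ := ⟨1, 0, 0, 1 / 2⟩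

/-- `scaleHalf • (y² = x³ + a) = (y² = x³ + 64a)`. [cite: SilvermanAEC2009, III.1 Table 3.1] -/
theorem scaleHalf_smul (a : ℚ) :
    scaleHalf • (⟨0, 0, 0, 0, a⟩ : WeierstrassCurve ℚ) = ⟨0, 0, 0, 0, 64 * a⟩ := by
  ext <;> simp [scaleHalf, WeierstrassCurve.variableChange_a₁,
    WeierstrassCurve.variableChange_a₂, WeierstrassCurve.variableChange_a₃,
    WeierstrassCurve.variableChange_a₄, WeierstrassCurve.variableChange_a₆]
  norm_num

/-- `scaleTwo • (y² = x³ + a) = (y² = x³ + a/64)`. [cite: SilvermanAEC2009, III.1 Table 3.1] -/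
theorem scaleTwo_smul (a : ℚ) :
    scaleTwo • (⟨0, 0, 0, 0, a⟩ : WeierstrassCurve ℚ) = ⟨0, 0, 0, 0, a / 64⟩ := by
  ext <;> simp [scaleTwo, WeierstrassCurve.variableChange_a₁,
    WeierstrassCurve.variableChange_a₂, WeierstrassCurve.variableChange_a₃,
    WeierstrassCurve.variableChange_a₄, WeierstrassCurve.variableChange_a₆]
  ring

/-- `shiftHalfT • (y² = x³ + a) = (y² + y = x³ + a − 1/4)`. [cite: SilvermanAEC2009, III.1 Table 3.1] -/
theorem shiftHalfT_smul (a : ℚ) :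
    shiftHalfT • (⟨0, 0, 0, 0, a⟩ : WeierstrassCurve ℚ) = ⟨0, 0, 1, 0, a - 1 / 4⟩ := by
  ext <;> simp [shiftHalfT, WeierstrassCurve.variableChange_a₁,
    WeierstrassCurve.variableChange_a₂, WeierstrassCurve.variableChange_a₃,
    WeierstrassCurve.variableChange_a₄, WeierstrassCurve.variableChange_a₆]
  norm_num

/-- `ord₃ u = 0` for `u(shiftHalfT) = 1`. [folklore] -/
theorem padicValRat_shiftHalfT_u : padicValRat 3 (shiftHalfT.u : ℚ) = 0 := by
  simp [shiftHalfT]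

/-- `ord₃ u = 0` for `u(scaleTwo) = 2`. [folklore] -/
theorem padicValRat_scaleTwo_u : padicValRat 3 (scaleTwo.u : ℚ) = 0 := by
  have h : ((scaleTwo.u : ℚ)) = ((2 : ℕ) : ℚ) := by simp [scaleTwo]
  rw [h, padicValRat.of_nat]
  simp [padicValNat.eq_zero_of_not_dvd (show ¬ 3 ∣ 2 by norm_num)]

/-- `ord₃ u = 0` for `u = 1` (`Cd = 1`). [folklore] -/
theorem padicValRat_one_u : padicValRat 3 ((1 : VariableChange ℚ).u : ℚ) = 0 := by
  have h : ((1 : VariableChange ℚ).u : ℚ) = 1 := rfl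
  rw [h]
  simp

/-- The twist of `[0, 0, a₃, 0, a₆]` by `D` is `y² = x³ + D³ (a₃² + 4 a₆)/4` (`b₂ = b₄ = 0`,
`b₆ = a₃² + 4a₆`). [cite: SilvermanAEC2009, X.5 Prop. 5.4(iii)] -/
theorem quadraticTwist_mk_a₃ (a₃ a₆ D : ℚ) :
    (⟨0, 0, a₃, 0, a₆⟩ : WeierstrassCurve ℚ).quadraticTwist D =
      ⟨0, 0, 0, 0, D ^ 3 * (a₃ ^ 2 + 4 * a₆) / 4⟩ := by
  ext
  · rfl
  · simp [WeierstrassCurve.quadraticTwist, WeierstrassCurve.b₂]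
  · rfl
  · simp [WeierstrassCurve.quadraticTwist, WeierstrassCurve.b₄]
  · simp only [WeierstrassCurve.quadraticTwist, WeierstrassCurve.b₆]

/-- A rational prime is squarefree in `ℤ`. [folklore] -/
theorem squarefree_intCast_of_prime {p : ℕ} (hp : p.Prime) : Squarefree (p : ℤ) :=
  Int.squarefree_natCast.mpr (Nat.prime_iff.mp hp).squarefree

/-! ### §2. The equations: census records `…1`, Kriz–Li curves `E_d = …2`, minimal twists `…2Tw` -/

/-- Cremona **225a1** `= [0,0,1,0,1]` (census record; `Δ = −3³·5²`). [cite: Cremona1997, Table 1 (class 225a)] -/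
def cremona225a1 : WeierstrassCurve ℚ := ⟨0, 0, 1, 0, 1⟩
/-- Cremona **225a2** `= [0,0,1,0,-34]` `≅ E_5 : y² = x³ − 2160` (`Δ = −3⁹·5²`). [cite: Cremona1997, Table 1 (class 225a)] -/
def cremona225a2 : WeierstrassCurve ℚ := ⟨0, 0, 1, 0, -34⟩
/-- `[0,0,1,0,44921]`: the globally minimal model of `225a2 ⊗ χ_{−11}` (conductor `27225`).
[cite: SilvermanAEC2009, X.5 Prop. 5.4] -/
def cremona225a2Tw : WeierstrassCurve ℚ := ⟨0, 0, 1, 0, 44921⟩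
/-- Cremona **1323m1** `= [0,0,1,0,-2]` (census record). [cite: Cremona1997, Table 1 (class 1323m)] -/
def cremona1323m1 : WeierstrassCurve ℚ := ⟨0, 0, 1, 0, -2⟩
/-- Cremona **1323m2** `= [0,0,1,0,47]` `≅ E_{−7} : y² = x³ + 3024`. [cite: Cremona1997, Table 1 (class 1323m)] -/
def cremona1323m2 : WeierstrassCurve ℚ := ⟨0, 0, 1, 0, 47⟩
/-- `[0,0,1,0,-4905637]`: the globally minimal model of `1323m2 ⊗ χ_{−47}` (conductor `2922507`).
[cite: SilvermanAEC2009, X.5 Prop. 5.4] -/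
def cremona1323m2Tw : WeierstrassCurve ℚ := ⟨0, 0, 1, 0, -4905637⟩
/-- Cremona **1728a1** `= [0,0,0,0,2]` (census record). [cite: Cremona1997, Table 1 (class 1728a)] -/
def cremona1728a1 : WeierstrassCurve ℚ := ⟨0, 0, 0, 0, 2⟩
/-- Cremona **1728a2** `= [0,0,0,0,-54]` `≅ E_8 : y² = x³ − 3456`. [cite: Cremona1997, Table 1 (class 1728a)] -/
def cremona1728a2 : WeierstrassCurve ℚ := ⟨0, 0, 0, 0, -54⟩
/-- `[0,0,0,0,657018]`: the globally minimal model of `1728a2 ⊗ χ_{−23}` (conductor `914112`).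
[cite: SilvermanAEC2009, X.5 Prop. 5.4] -/
def cremona1728a2Tw : WeierstrassCurve ℚ := ⟨0, 0, 0, 0, 657018⟩
/-- Cremona **3888t1** `= [0,0,0,0,3]` (census record). [cite: Cremona1997, Table 1 (class 3888t)] -/
def cremona3888t1 : WeierstrassCurve ℚ := ⟨0, 0, 0, 0, 3⟩
/-- Cremona **3888t2** `= [0,0,0,0,-81]` `≅ E_{12} : y² = x³ − 5184`. [cite: Cremona1997, Table 1 (class 3888t)] -/
def cremona3888t2 : WeierstrassCurve ℚ := ⟨0, 0, 0, 0, -81⟩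
/-- `[0,0,0,0,985527]`: the globally minimal model of `3888t2 ⊗ χ_{−23}` (conductor `2056752`).
[cite: SilvermanAEC2009, X.5 Prop. 5.4] -/
def cremona3888t2Tw : WeierstrassCurve ℚ := ⟨0, 0, 0, 0, 985527⟩
/-- Cremona **7803b1** `= [0,0,1,0,4]` (census record). [cite: Cremona1997, Table 1 (class 7803b)] -/
def cremona7803b1 : WeierstrassCurve ℚ := ⟨0, 0, 1, 0, 4⟩
/-- Cremona **7803b2** `= [0,0,1,0,-115]` `≅ E_{17} : y² = x³ − 7344`. [cite: Cremona1997, Table 1 (class 7803b)] -/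
def cremona7803b2 : WeierstrassCurve ℚ := ⟨0, 0, 1, 0, -115⟩
/-- `[0,0,0,0,918]`: the globally minimal model of `7803b2 ⊗ χ_{−8}` (conductor `499392`).
[cite: SilvermanAEC2009, X.5 Prop. 5.4] -/
def cremona7803b2Tw : WeierstrassCurve ℚ := ⟨0, 0, 0, 0, 918⟩
/-- Cremona **11907s1** `= [0,0,1,0,5]` (census record). [cite: Cremona1997, Table 1 (class 11907s)] -/
def cremona11907s1 : WeierstrassCurve ℚ := ⟨0, 0, 1, 0, 5⟩
/-- Cremona **11907s2** `= [0,0,1,0,-142]` `≅ E_{21} : y² = x³ − 9072`. [cite: Cremona1997, Table 1 (class 11907s)] -/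
def cremona11907s2 : WeierstrassCurve ℚ := ⟨0, 0, 1, 0, -142⟩
/-- `[0,0,1,0,14716910]`: the globally minimal model of `11907s2 ⊗ χ_{−47}` (conductor `26302563`).
[cite: SilvermanAEC2009, X.5 Prop. 5.4] -/
def cremona11907s2Tw : WeierstrassCurve ℚ := ⟨0, 0, 1, 0, 14716910⟩
/-- Cremona **15129a1** `= [0,0,1,0,10]` (census record). [cite: Cremona1997, Table 1 (class 15129a)] -/
def cremona15129a1 : WeierstrassCurve ℚ := ⟨0, 0, 1, 0, 10⟩
/-- Cremona **15129a2** `= [0,0,1,0,-277]` `≅ E_{41} : y² = x³ − 17712`. [cite: Cremona1997, Table 1 (class 15129a)] -/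
def cremona15129a2 : WeierstrassCurve ℚ := ⟨0, 0, 1, 0, -277⟩
/-- `[0,0,0,0,2214]`: the globally minimal model of `15129a2 ⊗ χ_{−8}` (conductor `968256`).
[cite: SilvermanAEC2009, X.5 Prop. 5.4] -/
def cremona15129a2Tw : WeierstrassCurve ℚ := ⟨0, 0, 0, 0, 2214⟩

/-! #### `IsElliptic` (`Δ = −27·b₆² ≠ 0`) -/

/-- elliptic (`b₆ ≠ 0`). [cite: SilvermanAEC2009, III.1] -/
instance isElliptic_cremona225a1 : cremona225a1.IsElliptic := isElliptic_mk (by norm_num)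
/-- elliptic (`b₆ ≠ 0`). [cite: SilvermanAEC2009, III.1] -/
instance isElliptic_cremona225a2 : cremona225a2.IsElliptic := isElliptic_mk (by norm_num)
/-- elliptic (`b₆ ≠ 0`). [cite: SilvermanAEC2009, III.1] -/
instance isElliptic_cremona225a2Tw : cremona225a2Tw.IsElliptic := isElliptic_mk (by norm_num)
/-- elliptic (`b₆ ≠ 0`). [cite: SilvermanAEC2009, III.1] -/
instance isElliptic_cremona1323m1 : cremona1323m1.IsElliptic := isElliptic_mk (by norm_num)
/-- elliptic (`b₆ ≠ 0`). [cite: SilvermanAEC2009, III.1] -/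
instance isElliptic_cremona1323m2 : cremona1323m2.IsElliptic := isElliptic_mk (by norm_num)
/-- elliptic (`b₆ ≠ 0`). [cite: SilvermanAEC2009, III.1] -/
instance isElliptic_cremona1323m2Tw : cremona1323m2Tw.IsElliptic := isElliptic_mk (by norm_num)
/-- elliptic (`b₆ ≠ 0`). [cite: SilvermanAEC2009, III.1] -/
instance isElliptic_cremona1728a1 : cremona1728a1.IsElliptic := isElliptic_mk (by norm_num)
/-- elliptic (`b₆ ≠ 0`). [cite: SilvermanAEC2009, III.1] -/
instance isElliptic_cremona1728a2 : cremona1728a2.IsElliptic := isElliptic_mk (by norm_num)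
/-- elliptic (`b₆ ≠ 0`). [cite: SilvermanAEC2009, III.1] -/
instance isElliptic_cremona1728a2Tw : cremona1728a2Tw.IsElliptic := isElliptic_mk (by norm_num)
/-- elliptic (`b₆ ≠ 0`). [cite: SilvermanAEC2009, III.1] -/
instance isElliptic_cremona3888t1 : cremona3888t1.IsElliptic := isElliptic_mk (by norm_num)
/-- elliptic (`b₆ ≠ 0`). [cite: SilvermanAEC2009, III.1] -/
instance isElliptic_cremona3888t2 : cremona3888t2.IsElliptic := isElliptic_mk (by norm_num)
/-- elliptic (`b₆ ≠ 0`). [cite: SilvermanAEC2009, III.1] -/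
instance isElliptic_cremona3888t2Tw : cremona3888t2Tw.IsElliptic := isElliptic_mk (by norm_num)
/-- elliptic (`b₆ ≠ 0`). [cite: SilvermanAEC2009, III.1] -/
instance isElliptic_cremona7803b1 : cremona7803b1.IsElliptic := isElliptic_mk (by norm_num)
/-- elliptic (`b₆ ≠ 0`). [cite: SilvermanAEC2009, III.1] -/
instance isElliptic_cremona7803b2 : cremona7803b2.IsElliptic := isElliptic_mk (by norm_num)
/-- elliptic (`b₆ ≠ 0`). [cite: SilvermanAEC2009, III.1] -/
instance isElliptic_cremona7803b2Tw : cremona7803b2Tw.IsElliptic := isElliptic_mk (by norm_num)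
/-- elliptic (`b₆ ≠ 0`). [cite: SilvermanAEC2009, III.1] -/
instance isElliptic_cremona11907s1 : cremona11907s1.IsElliptic := isElliptic_mk (by norm_num)
/-- elliptic (`b₆ ≠ 0`). [cite: SilvermanAEC2009, III.1] -/
instance isElliptic_cremona11907s2 : cremona11907s2.IsElliptic := isElliptic_mk (by norm_num)
/-- elliptic (`b₆ ≠ 0`). [cite: SilvermanAEC2009, III.1] -/
instance isElliptic_cremona11907s2Tw : cremona11907s2Tw.IsElliptic := isElliptic_mk (by norm_num)
/-- elliptic (`b₆ ≠ 0`). [cite: SilvermanAEC2009, III.1] -/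
instance isElliptic_cremona15129a1 : cremona15129a1.IsElliptic := isElliptic_mk (by norm_num)
/-- elliptic (`b₆ ≠ 0`). [cite: SilvermanAEC2009, III.1] -/
instance isElliptic_cremona15129a2 : cremona15129a2.IsElliptic := isElliptic_mk (by norm_num)
/-- elliptic (`b₆ ≠ 0`). [cite: SilvermanAEC2009, III.1] -/
instance isElliptic_cremona15129a2Tw : cremona15129a2Tw.IsElliptic := isElliptic_mk (by norm_num)

/-! #### `IsGloballyMinimal`, decided in the kernel (`X12CubeSum.isGloballyMinimal_mk`) -/

/-- 225a1 `[0,0,1,0,1]`: global minimal model (`Δ = −3³·5²`). [cite: SilvermanAEC2009, VII.1 Remark 1.1] -/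
instance isGloballyMinimal_cremona225a1 : cremona225a1.IsGloballyMinimal := by
  have := isGloballyMinimal_mk 1 1 50 (by norm_num) (by norm_num) (by norm_num) (by decide)
  simpa [cremona225a1] using this
/-- 225a2 `[0,0,1,0,-34]`: global minimal model (`Δ = −3⁹·5²`). [cite: SilvermanAEC2009, VII.1 Remark 1.1] -/
instance isGloballyMinimal_cremona225a2 : cremona225a2.IsGloballyMinimal := by
  have := isGloballyMinimal_mk 1 (-34) 50 (by norm_num) (by norm_num) (by norm_num) (by decide)
  simpa [cremona225a2] using this
/-- `[0,0,1,0,44921]`: global minimal model (`Δ = −3⁹·5²·11⁶`). [cite: SilvermanAEC2009, VII.1 Remark 1.1] -/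
instance isGloballyMinimal_cremona225a2Tw : cremona225a2Tw.IsGloballyMinimal := by
  have := isGloballyMinimal_mk 1 44921 50 (by norm_num) (by norm_num) (by norm_num) (by decide)
  simpa [cremona225a2Tw] using this
/-- 1323m1 `[0,0,1,0,-2]`: global minimal model (`Δ = −3³·7²`). [cite: SilvermanAEC2009, VII.1 Remark 1.1] -/
instance isGloballyMinimal_cremona1323m1 : cremona1323m1.IsGloballyMinimal := by
  have := isGloballyMinimal_mk 1 (-2) 50 (by norm_num) (by norm_num) (by norm_num) (by decide)
  simpa [cremona1323m1] using this
/-- 1323m2 `[0,0,1,0,47]`: global minimal model (`Δ = −3⁹·7²`). [cite: SilvermanAEC2009, VII.1 Remark 1.1] -/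
instance isGloballyMinimal_cremona1323m2 : cremona1323m2.IsGloballyMinimal := by
  have := isGloballyMinimal_mk 1 47 50 (by norm_num) (by norm_num) (by norm_num) (by decide)
  simpa [cremona1323m2] using this
/-- `[0,0,1,0,-4905637]`: global minimal model (`Δ = −3⁹·7²·47⁶`). [cite: SilvermanAEC2009, VII.1 Remark 1.1] -/
instance isGloballyMinimal_cremona1323m2Tw : cremona1323m2Tw.IsGloballyMinimal := by
  have := isGloballyMinimal_mk 1 (-4905637) 50 (by norm_num) (by norm_num) (by norm_num)
    (by decide)
  simpa [cremona1323m2Tw] using this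
/-- 1728a1 `[0,0,0,0,2]`: global minimal model (`Δ = −2⁶·3³`). [cite: SilvermanAEC2009, VII.1 Remark 1.1] -/
instance isGloballyMinimal_cremona1728a1 : cremona1728a1.IsGloballyMinimal := by
  have := isGloballyMinimal_mk 0 2 50 (by norm_num) (by norm_num) (by norm_num) (by decide)
  simpa [cremona1728a1] using this
/-- 1728a2 `[0,0,0,0,-54]`: global minimal model (`Δ = −2⁶·3⁹`). [cite: SilvermanAEC2009, VII.1 Remark 1.1] -/
instance isGloballyMinimal_cremona1728a2 : cremona1728a2.IsGloballyMinimal := by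
  have := isGloballyMinimal_mk 0 (-54) 50 (by norm_num) (by norm_num) (by norm_num) (by decide)
  simpa [cremona1728a2] using this
/-- `[0,0,0,0,657018]`: global minimal model (`Δ = −2⁶·3⁹·23⁶`). [cite: SilvermanAEC2009, VII.1 Remark 1.1] -/
instance isGloballyMinimal_cremona1728a2Tw : cremona1728a2Tw.IsGloballyMinimal := by
  have := isGloballyMinimal_mk 0 657018 50 (by norm_num) (by norm_num) (by norm_num) (by decide)
  simpa [cremona1728a2Tw] using this
/-- 3888t1 `[0,0,0,0,3]`: global minimal model (`Δ = −2⁴·3⁵`). [cite: SilvermanAEC2009, VII.1 Remark 1.1] -/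
instance isGloballyMinimal_cremona3888t1 : cremona3888t1.IsGloballyMinimal := by
  have := isGloballyMinimal_mk 0 3 50 (by norm_num) (by norm_num) (by norm_num) (by decide)
  simpa [cremona3888t1] using this
/-- 3888t2 `[0,0,0,0,-81]`: global minimal model (`Δ = −2⁴·3¹¹`). [cite: SilvermanAEC2009, VII.1 Remark 1.1] -/
instance isGloballyMinimal_cremona3888t2 : cremona3888t2.IsGloballyMinimal := by
  have := isGloballyMinimal_mk 0 (-81) 50 (by norm_num) (by norm_num) (by norm_num) (by decide)
  simpa [cremona3888t2] using this
/-- `[0,0,0,0,985527]`: global minimal model (`Δ = −2⁴·3¹¹·23⁶`). [cite: SilvermanAEC2009, VII.1 Remark 1.1] -/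
instance isGloballyMinimal_cremona3888t2Tw : cremona3888t2Tw.IsGloballyMinimal := by
  have := isGloballyMinimal_mk 0 985527 50 (by norm_num) (by norm_num) (by norm_num) (by decide)
  simpa [cremona3888t2Tw] using this
/-- 7803b1 `[0,0,1,0,4]`: global minimal model (`Δ = −3³·17²`). [cite: SilvermanAEC2009, VII.1 Remark 1.1] -/
instance isGloballyMinimal_cremona7803b1 : cremona7803b1.IsGloballyMinimal := by
  have := isGloballyMinimal_mk 1 4 50 (by norm_num) (by norm_num) (by norm_num) (by decide)
  simpa [cremona7803b1] using this
/-- 7803b2 `[0,0,1,0,-115]`: global minimal model (`Δ = −3⁹·17²`). [cite: SilvermanAEC2009, VII.1 Remark 1.1] -/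
instance isGloballyMinimal_cremona7803b2 : cremona7803b2.IsGloballyMinimal := by
  have := isGloballyMinimal_mk 1 (-115) 50 (by norm_num) (by norm_num) (by norm_num) (by decide)
  simpa [cremona7803b2] using this
/-- `[0,0,0,0,918]`: global minimal model (`Δ = −2⁶·3⁹·17²`). [cite: SilvermanAEC2009, VII.1 Remark 1.1] -/
instance isGloballyMinimal_cremona7803b2Tw : cremona7803b2Tw.IsGloballyMinimal := by
  have := isGloballyMinimal_mk 0 918 50 (by norm_num) (by norm_num) (by norm_num) (by decide)
  simpa [cremona7803b2Tw] using this
/-- 11907s1 `[0,0,1,0,5]`: global minimal model (`Δ = −3⁵·7²`). [cite: SilvermanAEC2009, VII.1 Remark 1.1] -/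
instance isGloballyMinimal_cremona11907s1 : cremona11907s1.IsGloballyMinimal := by
  have := isGloballyMinimal_mk 1 5 50 (by norm_num) (by norm_num) (by norm_num) (by decide)
  simpa [cremona11907s1] using this
/-- 11907s2 `[0,0,1,0,-142]`: global minimal model (`Δ = −3¹¹·7²`). [cite: SilvermanAEC2009, VII.1 Remark 1.1] -/
instance isGloballyMinimal_cremona11907s2 : cremona11907s2.IsGloballyMinimal := by
  have := isGloballyMinimal_mk 1 (-142) 50 (by norm_num) (by norm_num) (by norm_num) (by decide)
  simpa [cremona11907s2] using this
/-- `[0,0,1,0,14716910]`: global minimal model (`Δ = −3¹¹·7²·47⁶`). [cite: SilvermanAEC2009, VII.1 Remark 1.1] -/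
instance isGloballyMinimal_cremona11907s2Tw : cremona11907s2Tw.IsGloballyMinimal := by
  have := isGloballyMinimal_mk 1 14716910 50 (by norm_num) (by norm_num) (by norm_num)
    (by decide)
  simpa [cremona11907s2Tw] using this
/-- 15129a1 `[0,0,1,0,10]`: global minimal model (`Δ = −3³·41²`). [cite: SilvermanAEC2009, VII.1 Remark 1.1] -/
instance isGloballyMinimal_cremona15129a1 : cremona15129a1.IsGloballyMinimal := by
  have := isGloballyMinimal_mk 1 10 50 (by norm_num) (by norm_num) (by norm_num) (by decide)
  simpa [cremona15129a1] using this
/-- 15129a2 `[0,0,1,0,-277]`: global minimal model (`Δ = −3⁹·41²`). [cite: SilvermanAEC2009, VII.1 Remark 1.1] -/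
instance isGloballyMinimal_cremona15129a2 : cremona15129a2.IsGloballyMinimal := by
  have := isGloballyMinimal_mk 1 (-277) 50 (by norm_num) (by norm_num) (by norm_num) (by decide)
  simpa [cremona15129a2] using this
/-- `[0,0,0,0,2214]`: global minimal model (`Δ = −2⁶·3⁹·41²`). [cite: SilvermanAEC2009, VII.1 Remark 1.1] -/
instance isGloballyMinimal_cremona15129a2Tw : cremona15129a2Tw.IsGloballyMinimal := by
  have := isGloballyMinimal_mk 0 2214 50 (by norm_num) (by norm_num) (by norm_num) (by decide)
  simpa [cremona15129a2Tw] using this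

/-! ### §3. The seven `3`-isogenies `…1 ~ …2` (Cremona `allisog`: `[[1,3],[3,1]]`, resp. degree-`3` link inside 1728a) -/

/-- `225a1 ~ 225a2` (`64·1 + 16 = 80`, `64·(−34) + 16 = −2160 = −27·80`). [cite: Cremona1997, Table 1 (class 225a)] -/
theorem isIsogenous_cremona225a : IsIsogenous cremona225a1 cremona225a2 :=
  isIsogenous_of_a₆ (by norm_num) (by norm_num)
/-- `1323m1 ~ 1323m2` (`64·(−2) + 16 = −112`, `64·47 + 16 = 3024 = −27·(−112)`). [cite: Cremona1997, Table 1 (class 1323m)] -/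
theorem isIsogenous_cremona1323m : IsIsogenous cremona1323m1 cremona1323m2 :=
  isIsogenous_of_a₆ (by norm_num) (by norm_num)
/-- `7803b1 ~ 7803b2` (`64·4 + 16 = 272`, `64·(−115) + 16 = −7344 = −27·272`). [cite: Cremona1997, Table 1 (class 7803b)] -/
theorem isIsogenous_cremona7803b : IsIsogenous cremona7803b1 cremona7803b2 :=
  isIsogenous_of_a₆ (by norm_num) (by norm_num)
/-- `11907s1 ~ 11907s2` (`64·5 + 16 = 336`, `64·(−142) + 16 = −9072 = −27·336`). [cite: Cremona1997, Table 1 (class 11907s)] -/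
theorem isIsogenous_cremona11907s : IsIsogenous cremona11907s1 cremona11907s2 :=
  isIsogenous_of_a₆ (by norm_num) (by norm_num)
/-- `15129a1 ~ 15129a2` (`64·10 + 16 = 656`, `64·(−277) + 16 = −17712 = −27·656`). [cite: Cremona1997, Table 1 (class 15129a)] -/
theorem isIsogenous_cremona15129a : IsIsogenous cremona15129a1 cremona15129a2 :=
  isIsogenous_of_a₆ (by norm_num) (by norm_num)
/-- `1728a1 ~ 1728a2`: Vélu `y² = x³ + 2 → y² = x³ − 54`. [cite: Cremona1997, Table 1 (class 1728a)] -/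
theorem isIsogenous_cremona1728a : IsIsogenous cremona1728a1 cremona1728a2 := by
  have h := isIsogenous_mk_a₆ (c := (2 : ℚ)) (by norm_num)
  norm_num at h
  exact h
/-- `3888t1 ~ 3888t2`: Vélu `y² = x³ + 3 → y² = x³ − 81`. [cite: Cremona1997, Table 1 (class 3888t)] -/
theorem isIsogenous_cremona3888t : IsIsogenous cremona3888t1 cremona3888t2 := by
  have h := isIsogenous_mk_a₆ (c := (3 : ℚ)) (by norm_num)
  norm_num at h
  exact h

/-! ### §4. The identifications `…2 ≅ E_d` and `Cd • (…2)^{(d_K)} = …2Tw` -/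

/-- `225a2 ≅ E_5 : y² = x³ − 432·5`. [cite: KrizLi2019, Def. 1.19 (E_d)] -/
theorem cremona225a2_eq : ∃ C : VariableChange ℚ,
    C • cremona225a2 = ⟨0, 0, 0, 0, -432 * ((5 : ℤ) : ℚ)⟩ :=
  ⟨halfScale, by rw [show cremona225a2 = ⟨0, 0, 1, 0, -34⟩ from rfl, halfScale_smul]; norm_num⟩
/-- `1323m2 ≅ E_{−7} : y² = x³ + 3024`. [cite: KrizLi2019, Def. 1.19 (E_d)] -/
theorem cremona1323m2_eq : ∃ C : VariableChange ℚ,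
    C • cremona1323m2 = ⟨0, 0, 0, 0, -432 * ((-7 : ℤ) : ℚ)⟩ :=
  ⟨halfScale, by rw [show cremona1323m2 = ⟨0, 0, 1, 0, 47⟩ from rfl, halfScale_smul]; norm_num⟩
/-- `1728a2 ≅ E_8 : y² = x³ − 3456` (scaling `u = 1/2`). [cite: KrizLi2019, Def. 1.19 (E_d)] -/
theorem cremona1728a2_eq : ∃ C : VariableChange ℚ,
    C • cremona1728a2 = ⟨0, 0, 0, 0, -432 * ((8 : ℤ) : ℚ)⟩ :=
  ⟨scaleHalf, by rw [show cremona1728a2 = ⟨0, 0, 0, 0, -54⟩ from rfl, scaleHalf_smul]; norm_num⟩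
/-- `3888t2 ≅ E_{12} : y² = x³ − 5184` (scaling `u = 1/2`). [cite: KrizLi2019, Def. 1.19 (E_d)] -/
theorem cremona3888t2_eq : ∃ C : VariableChange ℚ,
    C • cremona3888t2 = ⟨0, 0, 0, 0, -432 * ((12 : ℤ) : ℚ)⟩ :=
  ⟨scaleHalf, by rw [show cremona3888t2 = ⟨0, 0, 0, 0, -81⟩ from rfl, scaleHalf_smul]; norm_num⟩
/-- `7803b2 ≅ E_{17} : y² = x³ − 7344`. [cite: KrizLi2019, Def. 1.19 (E_d)] -/
theorem cremona7803b2_eq : ∃ C : VariableChange ℚ,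
    C • cremona7803b2 = ⟨0, 0, 0, 0, -432 * ((17 : ℤ) : ℚ)⟩ :=
  ⟨halfScale, by rw [show cremona7803b2 = ⟨0, 0, 1, 0, -115⟩ from rfl, halfScale_smul]; norm_num⟩
/-- `11907s2 ≅ E_{21} : y² = x³ − 9072`. [cite: KrizLi2019, Def. 1.19 (E_d)] -/
theorem cremona11907s2_eq : ∃ C : VariableChange ℚ,
    C • cremona11907s2 = ⟨0, 0, 0, 0, -432 * ((21 : ℤ) : ℚ)⟩ :=
  ⟨halfScale, by rw [show cremona11907s2 = ⟨0, 0, 1, 0, -142⟩ from rfl, halfScale_smul]; norm_num⟩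
/-- `15129a2 ≅ E_{41} : y² = x³ − 17712`. [cite: KrizLi2019, Def. 1.19 (E_d)] -/
theorem cremona15129a2_eq : ∃ C : VariableChange ℚ,
    C • cremona15129a2 = ⟨0, 0, 0, 0, -432 * ((41 : ℤ) : ℚ)⟩ :=
  ⟨halfScale, by rw [show cremona15129a2 = ⟨0, 0, 1, 0, -277⟩ from rfl, halfScale_smul]; norm_num⟩

/-- `shiftHalfT • 225a2^{(−11)} = [0,0,1,0,44921]`. [cite: SilvermanAEC2009, X.5 Prop. 5.4] -/
theorem cremona225a2_twist :
    shiftHalfT • cremona225a2.quadraticTwist (((-11 : ℤ) : ℚ)) = cremona225a2Tw := by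
  rw [show cremona225a2 = ⟨0, 0, 1, 0, -34⟩ from rfl, quadraticTwist_mk_a₃, shiftHalfT_smul]
  simp only [cremona225a2Tw]
  norm_num
/-- `shiftHalfT • 1323m2^{(−47)} = [0,0,1,0,−4905637]`. [cite: SilvermanAEC2009, X.5 Prop. 5.4] -/
theorem cremona1323m2_twist :
    shiftHalfT • cremona1323m2.quadraticTwist (((-47 : ℤ) : ℚ)) = cremona1323m2Tw := by
  rw [show cremona1323m2 = ⟨0, 0, 1, 0, 47⟩ from rfl, quadraticTwist_mk_a₃, shiftHalfT_smul]
  simp only [cremona1323m2Tw]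
  norm_num
/-- `1 • 1728a2^{(−23)} = [0,0,0,0,657018]`. [cite: SilvermanAEC2009, X.5 Prop. 5.4] -/
theorem cremona1728a2_twist :
    (1 : VariableChange ℚ) • cremona1728a2.quadraticTwist (((-23 : ℤ) : ℚ)) = cremona1728a2Tw := by
  rw [one_smul, show cremona1728a2 = ⟨0, 0, 0, 0, -54⟩ from rfl, quadraticTwist_mk_a₃]
  simp only [cremona1728a2Tw]
  norm_num
/-- `1 • 3888t2^{(−23)} = [0,0,0,0,985527]`. [cite: SilvermanAEC2009, X.5 Prop. 5.4] -/
theorem cremona3888t2_twist :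
    (1 : VariableChange ℚ) • cremona3888t2.quadraticTwist (((-23 : ℤ) : ℚ)) = cremona3888t2Tw := by
  rw [one_smul, show cremona3888t2 = ⟨0, 0, 0, 0, -81⟩ from rfl, quadraticTwist_mk_a₃]
  simp only [cremona3888t2Tw]
  norm_num
/-- `scaleTwo • 7803b2^{(−8)} = [0,0,0,0,918]`. [cite: SilvermanAEC2009, X.5 Prop. 5.4] -/
theorem cremona7803b2_twist :
    scaleTwo • cremona7803b2.quadraticTwist (((-8 : ℤ) : ℚ)) = cremona7803b2Tw := by
  rw [show cremona7803b2 = ⟨0, 0, 1, 0, -115⟩ from rfl, quadraticTwist_mk_a₃, scaleTwo_smul]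
  simp only [cremona7803b2Tw]
  norm_num
/-- `shiftHalfT • 11907s2^{(−47)} = [0,0,1,0,14716910]`. [cite: SilvermanAEC2009, X.5 Prop. 5.4] -/
theorem cremona11907s2_twist :
    shiftHalfT • cremona11907s2.quadraticTwist (((-47 : ℤ) : ℚ)) = cremona11907s2Tw := by
  rw [show cremona11907s2 = ⟨0, 0, 1, 0, -142⟩ from rfl, quadraticTwist_mk_a₃, shiftHalfT_smul]
  simp only [cremona11907s2Tw]
  norm_num
/-- `scaleTwo • 15129a2^{(−8)} = [0,0,0,0,2214]`. [cite: SilvermanAEC2009, X.5 Prop. 5.4] -/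
theorem cremona15129a2_twist :
    scaleTwo • cremona15129a2.quadraticTwist (((-8 : ℤ) : ℚ)) = cremona15129a2Tw := by
  rw [show cremona15129a2 = ⟨0, 0, 1, 0, -277⟩ from rfl, quadraticTwist_mk_a₃, scaleTwo_smul]
  simp only [cremona15129a2Tw]
  norm_num

/-! ### §5. The transport, packaged once -/

/-- **Kriz–Li + transport, generic form.** For a census record `W₁ ~ W₂ ≅ E_d` (the `3`-isogeny
in the kernel), `r_an(W₁) = 1`, the discriminant of `K` pinned to `D`, and the data / facts /
side conditions of `KrizLi2019.bsdp_three_of_thm1010` for `W₂`: `rank W₂(ℚ) = 1 ∧ BSD(W₂, 3)`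
and `r_an(W₁) = 1 ∧ BSD(W₁, 3)`. Finiteness of `Ш(W₂/ℚ)` for Cassels' transport comes from
Kolyvagin over `K` (`kolyvagin`, the Heegner point being non-torsion by Kriz–Li Thm. 10.6) and
descent of finiteness (`shaFinite_of_baseChange`); `r_an(W₂) = r_an(W₁)` by isogeny invariance.
[cite: KrizLi2019, Thm. 1.23 = Thm. 10.10] [cite: MilneADT2006, Thm. I.7.3] [cite: Kolyvagin1990, Thm. A] -/
theorem bsdp_three_transport (d D : ℤ) (N : ℕ) [NeZero N] (W₁ W₂ Wd : WeierstrassCurve ℚ)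
    [W₁.IsElliptic] [W₁.IsGloballyMinimal] [W₂.IsElliptic] [W₂.IsGloballyMinimal]
    [Wd.IsElliptic] [Wd.IsGloballyMinimal]
    (K : Type) [Field K] [NumberField K]
    (Dt : ModularParametrizationData W₂ N) (H : HeegnerDatum N (NumberField.discr K)) (ι : K →+* ℂ)
    (P : (W₂.baseChange K).toAffine.Point)
    (h : thm1010_bsdThree_overK_sexticTwist) (hGZ : gross_zagier N W₂ K) (hKo : kolyvagin N W₂ K)
    (hCM0 : bsdTriple_of_hasCM_of_L_one_ne_zero) (hmod : hasEntireLFunction_rat)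
    (hCassels : bsdRHS_eq_of_isIsogenous)
    (hiso : IsIsogenous W₁ W₂)
    (hW : ∃ C : VariableChange ℚ, C • W₂ = ({ a₁ := 0, a₂ := 0, a₃ := 0, a₄ := 0, a₆ := -432 * d } :
      WeierstrassCurve ℚ))
    (hN : W₂.conductorNorm ℤ = N) (hK : IsImaginaryQuadratic K) (hD : NumberField.discr K = D)
    (hH : SatisfiesHeegnerHypothesis (3 * d.natAbs) K) (hHN : SatisfiesHeegnerHypothesis N K)
    (hP : WeierstrassCurve.Affine.Point.map ι.toRatAlgHom P = heegnerPointComplex Dt H)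
    (h1 : (d % 4 = 1 ∧ Squarefree d ∧ d ≠ 1) ∨
      (4 ∣ d ∧ (d / 4 % 4 = 2 ∨ d / 4 % 4 = 3) ∧ Squarefree (d / 4)))
    (h9 : d % 9 = 2 ∨ d % 9 = 3 ∨ d % 9 = 5 ∨ d % 9 = 8)
    (h3pos : 0 < d → ThreeClassNumberTrivial (-3 * d) ∧ ThreeClassNumberTrivial (D * d))
    (h3neg : d < 0 → ThreeClassNumberTrivial d ∧ ThreeClassNumberTrivial (-3 * D * d))
    (h4 : ¬ (3 : ℤ) ∣ Dt.c) (hr : W₁.analyticRank = 1)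
    (Cd : VariableChange ℚ) (hWd : Cd • W₂.quadraticTwist ((D : ℤ) : ℚ) = Wd)
    (htam : padicValNat 3 Wd.tamagawaProduct = padicValNat 3 W₂.tamagawaProduct)
    (hu : padicValRat 3 (Cd.u : ℚ) = 0) (hμ : ¬ 3 ∣ Units.torsionOrder K) :
    (W₂.mordellWeilRank = 1 ∧ BSDp W₂ 3) ∧ (W₁.analyticRank = 1 ∧ BSDp W₁ 3) := by
  subst hD
  have hr₂ : W₂.analyticRank = 1 := (analyticRank_eq_of_isIsogenous' hiso).symm.trans hr
  have hmain := bsdp_three_of_thm1010 d W₂ N K Dt H ι P h hGZ hKo hCM0 hmod hW hN hK hH hHN hP h1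
    h9 h3pos h3neg h4 hr₂ Wd Cd hWd htam hu hμ
  -- `Ш(W₂/ℚ)` finite: Kriz–Li Thm. 10.6 (`P` non-torsion) + Kolyvagin over `K` + descent
  obtain ⟨hPinf, -, -, -⟩ := h d W₂ N K Dt H ι P hW hN hK hH hP h1 h9 h3pos h3neg h4
  obtain ⟨-, hShaK⟩ := hKo hK hHN ⟨Dt, H, ι, hP⟩ hPinf
  have hfin : Finite W₂.sha := shaFinite_of_baseChange W₂ K hShaK
  exact ⟨hmain, bsdp_three_of_isIsogenous hCassels hmod hiso hr₂ hfin hmain.2⟩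

/-! ### §6. The seven census records -/

/-- **225a** (`d = 5`, `N = 225 = 3²·5²`, `K = ℚ(√−11)`): `rank = 1 ∧ BSD(225a2, 3)` and
`r_an = 1 ∧ BSD(225a1, 3)` from the published facts, the Gross–Zagier data of the pair, the
arithmetic inputs `N(225a2) = 225`, `h₃(−15) = h₃(−55) = 1`, `ord₃ Tam([0,0,1,0,44921]) =
ord₃ Tam(225a2)`, `3 ∤ #μ(K)`, and the census datum `r_an(225a1) = 1`. Discharged in the kernel:
minimality (three models), the isogeny, `225a2 ≅ E_5`, the twist model and `ord₃ u = 0`,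
hypotheses (1), (2). [cite: KrizLi2019, Thm. 1.23 = Thm. 10.10] [cite: Cremona1997, Table 1 (class 225a)] -/
theorem bsdp_three_cremona225a (K : Type) [Field K] [NumberField K]
    (Dt : ModularParametrizationData cremona225a2 225) (H : HeegnerDatum 225 (NumberField.discr K))
    (ι : K →+* ℂ) (P : (cremona225a2.baseChange K).toAffine.Point)
    (h : thm1010_bsdThree_overK_sexticTwist) (hGZ : gross_zagier 225 cremona225a2 K)
    (hKo : kolyvagin 225 cremona225a2 K) (hCM0 : bsdTriple_of_hasCM_of_L_one_ne_zero)
    (hmod : hasEntireLFunction_rat) (hCassels : bsdRHS_eq_of_isIsogenous)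
    (hK : IsImaginaryQuadratic K) (hD : NumberField.discr K = -11)
    (hH : SatisfiesHeegnerHypothesis 15 K) (hHN : SatisfiesHeegnerHypothesis 225 K)
    (hP : WeierstrassCurve.Affine.Point.map ι.toRatAlgHom P = heegnerPointComplex Dt H)
    (h4 : ¬ (3 : ℤ) ∣ Dt.c) (hN : cremona225a2.conductorNorm ℤ = 225)
    (h3a : ThreeClassNumberTrivial (-15)) (h3b : ThreeClassNumberTrivial (-55))
    (htam : padicValNat 3 cremona225a2Tw.tamagawaProduct = padicValNat 3 cremona225a2.tamagawaProduct)
    (hμ : ¬ 3 ∣ Units.torsionOrder K) (hr : cremona225a1.analyticRank = 1) :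
    (cremona225a2.mordellWeilRank = 1 ∧ BSDp cremona225a2 3) ∧
      (cremona225a1.analyticRank = 1 ∧ BSDp cremona225a1 3) :=
  haveI : NeZero (225 : ℕ) := ⟨by norm_num⟩
  bsdp_three_transport 5 (-11) 225 cremona225a1 cremona225a2 cremona225a2Tw K Dt H ι P h hGZ hKo
    hCM0 hmod hCassels isIsogenous_cremona225a cremona225a2_eq hN hK hD (by simpa using hH) hHN hP
    (Or.inl ⟨by norm_num, by exact_mod_cast squarefree_intCast_of_prime (by norm_num : Nat.Prime 5),
      by norm_num⟩) (by norm_num)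
    (fun _ => ⟨by norm_num; exact h3a, by norm_num; exact h3b⟩) (fun h => absurd h (by norm_num))
    h4 hr shiftHalfT cremona225a2_twist htam padicValRat_shiftHalfT_u hμ

/-- **1323m** (`d = -7`, `N = 1323 = 3³·7²`, `K = ℚ(√-47)`): `rank = 1 ∧ BSD(1323m2, 3)` and
`r_an = 1 ∧ BSD(1323m1, 3)` from the published facts, the Gross–Zagier data of the pair, the
arithmetic inputs `N(1323m2) = 1323`, `h₃(-7) = h₃(-987) = 1`, `ord₃ Tam([0,0,1,0,-4905637]) = ord₃ Tam(1323m2)`,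
`3 ∤ #μ(K)`, and the census datum `r_an(1323m1) = 1`; minimality, isogeny, `1323m2 ≅ E_d`, the
twist model with `ord₃ u = 0`, hypotheses (1), (2) discharged in the kernel.
[cite: KrizLi2019, Thm. 1.23 = Thm. 10.10] [cite: Cremona1997, Table 1 (class 1323m)] -/
theorem bsdp_three_cremona1323m (K : Type) [Field K] [NumberField K]
    (Dt : ModularParametrizationData cremona1323m2 1323) (H : HeegnerDatum 1323 (NumberField.discr K))
    (ι : K →+* ℂ) (P : (cremona1323m2.baseChange K).toAffine.Point)
    (h : thm1010_bsdThree_overK_sexticTwist) (hGZ : gross_zagier 1323 cremona1323m2 K)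
    (hKo : kolyvagin 1323 cremona1323m2 K) (hCM0 : bsdTriple_of_hasCM_of_L_one_ne_zero)
    (hmod : hasEntireLFunction_rat) (hCassels : bsdRHS_eq_of_isIsogenous)
    (hK : IsImaginaryQuadratic K) (hD : NumberField.discr K = -47)
    (hH : SatisfiesHeegnerHypothesis 21 K) (hHN : SatisfiesHeegnerHypothesis 1323 K)
    (hP : WeierstrassCurve.Affine.Point.map ι.toRatAlgHom P = heegnerPointComplex Dt H)
    (h4 : ¬ (3 : ℤ) ∣ Dt.c) (hN : cremona1323m2.conductorNorm ℤ = 1323)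
    (h3a : ThreeClassNumberTrivial (-7)) (h3b : ThreeClassNumberTrivial (-987))
    (htam : padicValNat 3 cremona1323m2Tw.tamagawaProduct = padicValNat 3 cremona1323m2.tamagawaProduct)
    (hμ : ¬ 3 ∣ Units.torsionOrder K) (hr : cremona1323m1.analyticRank = 1) :
    (cremona1323m2.mordellWeilRank = 1 ∧ BSDp cremona1323m2 3) ∧
      (cremona1323m1.analyticRank = 1 ∧ BSDp cremona1323m1 3) :=
  haveI : NeZero (1323 : ℕ) := ⟨by norm_num⟩
  bsdp_three_transport (-7) (-47) 1323 cremona1323m1 cremona1323m2 cremona1323m2Tw K Dt H ι P h hGZ hKo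
    hCM0 hmod hCassels isIsogenous_cremona1323m cremona1323m2_eq hN hK hD (by simpa using hH) hHN hP
    (Or.inl ⟨by norm_num, Int.squarefree_natAbs.mp (by simpa using (Nat.prime_iff.mp (by norm_num : Nat.Prime 7)).squarefree),
      by norm_num⟩) (by norm_num)
    (fun h => absurd h (by norm_num)) (fun _ => ⟨h3a, by norm_num; exact h3b⟩)
    h4 hr shiftHalfT cremona1323m2_twist htam padicValRat_shiftHalfT_u hμ

/-- **1728a** (`d = 8`, `N = 1728 = 2⁶·3³`, `K = ℚ(√-23)`): `rank = 1 ∧ BSD(1728a2, 3)` and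
`r_an = 1 ∧ BSD(1728a1, 3)` from the published facts, the Gross–Zagier data of the pair, the
arithmetic inputs `N(1728a2) = 1728`, `h₃(-24) = h₃(-184) = 1`, `ord₃ Tam([0,0,0,0,657018]) = ord₃ Tam(1728a2)`,
`3 ∤ #μ(K)`, and the census datum `r_an(1728a1) = 1`; minimality, isogeny, `1728a2 ≅ E_d`, the
twist model with `ord₃ u = 0`, hypotheses (1), (2) discharged in the kernel.
[cite: KrizLi2019, Thm. 1.23 = Thm. 10.10] [cite: Cremona1997, Table 1 (class 1728a)] -/
theorem bsdp_three_cremona1728a (K : Type) [Field K] [NumberField K]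
    (Dt : ModularParametrizationData cremona1728a2 1728) (H : HeegnerDatum 1728 (NumberField.discr K))
    (ι : K →+* ℂ) (P : (cremona1728a2.baseChange K).toAffine.Point)
    (h : thm1010_bsdThree_overK_sexticTwist) (hGZ : gross_zagier 1728 cremona1728a2 K)
    (hKo : kolyvagin 1728 cremona1728a2 K) (hCM0 : bsdTriple_of_hasCM_of_L_one_ne_zero)
    (hmod : hasEntireLFunction_rat) (hCassels : bsdRHS_eq_of_isIsogenous)
    (hK : IsImaginaryQuadratic K) (hD : NumberField.discr K = -23)
    (hH : SatisfiesHeegnerHypothesis 24 K) (hHN : SatisfiesHeegnerHypothesis 1728 K)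
    (hP : WeierstrassCurve.Affine.Point.map ι.toRatAlgHom P = heegnerPointComplex Dt H)
    (h4 : ¬ (3 : ℤ) ∣ Dt.c) (hN : cremona1728a2.conductorNorm ℤ = 1728)
    (h3a : ThreeClassNumberTrivial (-24)) (h3b : ThreeClassNumberTrivial (-184))
    (htam : padicValNat 3 cremona1728a2Tw.tamagawaProduct = padicValNat 3 cremona1728a2.tamagawaProduct)
    (hμ : ¬ 3 ∣ Units.torsionOrder K) (hr : cremona1728a1.analyticRank = 1) :
    (cremona1728a2.mordellWeilRank = 1 ∧ BSDp cremona1728a2 3) ∧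
      (cremona1728a1.analyticRank = 1 ∧ BSDp cremona1728a1 3) :=
  haveI : NeZero (1728 : ℕ) := ⟨by norm_num⟩
  bsdp_three_transport (8) (-23) 1728 cremona1728a1 cremona1728a2 cremona1728a2Tw K Dt H ι P h hGZ hKo
    hCM0 hmod hCassels isIsogenous_cremona1728a cremona1728a2_eq hN hK hD (by simpa using hH) hHN hP
    (Or.inr ⟨by norm_num, Or.inl (by norm_num),
      by rw [show (8 : ℤ) / 4 = 2 by norm_num]; exact_mod_cast squarefree_intCast_of_prime Nat.prime_two⟩) (by norm_num)
    (fun _ => ⟨by norm_num; exact h3a, by norm_num; exact h3b⟩) (fun h => absurd h (by norm_num))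
    h4 hr (1 : VariableChange ℚ) cremona1728a2_twist htam padicValRat_one_u hμ

/-- **3888t** (`d = 12`, `N = 3888 = 2⁴·3⁵`, `K = ℚ(√-23)`): `rank = 1 ∧ BSD(3888t2, 3)` and
`r_an = 1 ∧ BSD(3888t1, 3)` from the published facts, the Gross–Zagier data of the pair, the
arithmetic inputs `N(3888t2) = 3888`, `h₃(-36) = h₃(-276) = 1`, `ord₃ Tam([0,0,0,0,985527]) = ord₃ Tam(3888t2)`,
`3 ∤ #μ(K)`, and the census datum `r_an(3888t1) = 1`; minimality, isogeny, `3888t2 ≅ E_d`, the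
twist model with `ord₃ u = 0`, hypotheses (1), (2) discharged in the kernel.
[cite: KrizLi2019, Thm. 1.23 = Thm. 10.10] [cite: Cremona1997, Table 1 (class 3888t)] -/
theorem bsdp_three_cremona3888t (K : Type) [Field K] [NumberField K]
    (Dt : ModularParametrizationData cremona3888t2 3888) (H : HeegnerDatum 3888 (NumberField.discr K))
    (ι : K →+* ℂ) (P : (cremona3888t2.baseChange K).toAffine.Point)
    (h : thm1010_bsdThree_overK_sexticTwist) (hGZ : gross_zagier 3888 cremona3888t2 K)
    (hKo : kolyvagin 3888 cremona3888t2 K) (hCM0 : bsdTriple_of_hasCM_of_L_one_ne_zero)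
    (hmod : hasEntireLFunction_rat) (hCassels : bsdRHS_eq_of_isIsogenous)
    (hK : IsImaginaryQuadratic K) (hD : NumberField.discr K = -23)
    (hH : SatisfiesHeegnerHypothesis 36 K) (hHN : SatisfiesHeegnerHypothesis 3888 K)
    (hP : WeierstrassCurve.Affine.Point.map ι.toRatAlgHom P = heegnerPointComplex Dt H)
    (h4 : ¬ (3 : ℤ) ∣ Dt.c) (hN : cremona3888t2.conductorNorm ℤ = 3888)
    (h3a : ThreeClassNumberTrivial (-36)) (h3b : ThreeClassNumberTrivial (-276))
    (htam : padicValNat 3 cremona3888t2Tw.tamagawaProduct = padicValNat 3 cremona3888t2.tamagawaProduct)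
    (hμ : ¬ 3 ∣ Units.torsionOrder K) (hr : cremona3888t1.analyticRank = 1) :
    (cremona3888t2.mordellWeilRank = 1 ∧ BSDp cremona3888t2 3) ∧
      (cremona3888t1.analyticRank = 1 ∧ BSDp cremona3888t1 3) :=
  haveI : NeZero (3888 : ℕ) := ⟨by norm_num⟩
  bsdp_three_transport (12) (-23) 3888 cremona3888t1 cremona3888t2 cremona3888t2Tw K Dt H ι P h hGZ hKo
    hCM0 hmod hCassels isIsogenous_cremona3888t cremona3888t2_eq hN hK hD (by simpa using hH) hHN hP
    (Or.inr ⟨by norm_num, Or.inr (by norm_num),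
      by rw [show (12 : ℤ) / 4 = 3 by norm_num]; exact_mod_cast squarefree_intCast_of_prime Nat.prime_three⟩) (by norm_num)
    (fun _ => ⟨by norm_num; exact h3a, by norm_num; exact h3b⟩) (fun h => absurd h (by norm_num))
    h4 hr (1 : VariableChange ℚ) cremona3888t2_twist htam padicValRat_one_u hμ

/-- **7803b** (`d = 17`, `N = 7803 = 3³·17²`, `K = ℚ(√-8)`): `rank = 1 ∧ BSD(7803b2, 3)` and
`r_an = 1 ∧ BSD(7803b1, 3)` from the published facts, the Gross–Zagier data of the pair, the
arithmetic inputs `N(7803b2) = 7803`, `h₃(-51) = h₃(-136) = 1`, `ord₃ Tam([0,0,0,0,918]) = ord₃ Tam(7803b2)`,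
`3 ∤ #μ(K)`, and the census datum `r_an(7803b1) = 1`; minimality, isogeny, `7803b2 ≅ E_d`, the
twist model with `ord₃ u = 0`, hypotheses (1), (2) discharged in the kernel.
[cite: KrizLi2019, Thm. 1.23 = Thm. 10.10] [cite: Cremona1997, Table 1 (class 7803b)] -/
theorem bsdp_three_cremona7803b (K : Type) [Field K] [NumberField K]
    (Dt : ModularParametrizationData cremona7803b2 7803) (H : HeegnerDatum 7803 (NumberField.discr K))
    (ι : K →+* ℂ) (P : (cremona7803b2.baseChange K).toAffine.Point)
    (h : thm1010_bsdThree_overK_sexticTwist) (hGZ : gross_zagier 7803 cremona7803b2 K)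
    (hKo : kolyvagin 7803 cremona7803b2 K) (hCM0 : bsdTriple_of_hasCM_of_L_one_ne_zero)
    (hmod : hasEntireLFunction_rat) (hCassels : bsdRHS_eq_of_isIsogenous)
    (hK : IsImaginaryQuadratic K) (hD : NumberField.discr K = -8)
    (hH : SatisfiesHeegnerHypothesis 51 K) (hHN : SatisfiesHeegnerHypothesis 7803 K)
    (hP : WeierstrassCurve.Affine.Point.map ι.toRatAlgHom P = heegnerPointComplex Dt H)
    (h4 : ¬ (3 : ℤ) ∣ Dt.c) (hN : cremona7803b2.conductorNorm ℤ = 7803)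
    (h3a : ThreeClassNumberTrivial (-51)) (h3b : ThreeClassNumberTrivial (-136))
    (htam : padicValNat 3 cremona7803b2Tw.tamagawaProduct = padicValNat 3 cremona7803b2.tamagawaProduct)
    (hμ : ¬ 3 ∣ Units.torsionOrder K) (hr : cremona7803b1.analyticRank = 1) :
    (cremona7803b2.mordellWeilRank = 1 ∧ BSDp cremona7803b2 3) ∧
      (cremona7803b1.analyticRank = 1 ∧ BSDp cremona7803b1 3) :=
  haveI : NeZero (7803 : ℕ) := ⟨by norm_num⟩
  bsdp_three_transport (17) (-8) 7803 cremona7803b1 cremona7803b2 cremona7803b2Tw K Dt H ι P h hGZ hKo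
    hCM0 hmod hCassels isIsogenous_cremona7803b cremona7803b2_eq hN hK hD (by simpa using hH) hHN hP
    (Or.inl ⟨by norm_num, by exact_mod_cast squarefree_intCast_of_prime (by norm_num : Nat.Prime 17),
      by norm_num⟩) (by norm_num)
    (fun _ => ⟨by norm_num; exact h3a, by norm_num; exact h3b⟩) (fun h => absurd h (by norm_num))
    h4 hr scaleTwo cremona7803b2_twist htam padicValRat_scaleTwo_u hμ

/-- **11907s** (`d = 21`, `N = 11907 = 3⁵·7²`, `K = ℚ(√-47)`): `rank = 1 ∧ BSD(11907s2, 3)` and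
`r_an = 1 ∧ BSD(11907s1, 3)` from the published facts, the Gross–Zagier data of the pair, the
arithmetic inputs `N(11907s2) = 11907`, `h₃(-63) = h₃(-987) = 1`, `ord₃ Tam([0,0,1,0,14716910]) = ord₃ Tam(11907s2)`,
`3 ∤ #μ(K)`, and the census datum `r_an(11907s1) = 1`; minimality, isogeny, `11907s2 ≅ E_d`, the
twist model with `ord₃ u = 0`, hypotheses (1), (2) discharged in the kernel.
[cite: KrizLi2019, Thm. 1.23 = Thm. 10.10] [cite: Cremona1997, Table 1 (class 11907s)] -/
theorem bsdp_three_cremona11907s (K : Type) [Field K] [NumberField K]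
    (Dt : ModularParametrizationData cremona11907s2 11907) (H : HeegnerDatum 11907 (NumberField.discr K))
    (ι : K →+* ℂ) (P : (cremona11907s2.baseChange K).toAffine.Point)
    (h : thm1010_bsdThree_overK_sexticTwist) (hGZ : gross_zagier 11907 cremona11907s2 K)
    (hKo : kolyvagin 11907 cremona11907s2 K) (hCM0 : bsdTriple_of_hasCM_of_L_one_ne_zero)
    (hmod : hasEntireLFunction_rat) (hCassels : bsdRHS_eq_of_isIsogenous)
    (hK : IsImaginaryQuadratic K) (hD : NumberField.discr K = -47)
    (hH : SatisfiesHeegnerHypothesis 63 K) (hHN : SatisfiesHeegnerHypothesis 11907 K)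
    (hP : WeierstrassCurve.Affine.Point.map ι.toRatAlgHom P = heegnerPointComplex Dt H)
    (h4 : ¬ (3 : ℤ) ∣ Dt.c) (hN : cremona11907s2.conductorNorm ℤ = 11907)
    (h3a : ThreeClassNumberTrivial (-63)) (h3b : ThreeClassNumberTrivial (-987))
    (htam : padicValNat 3 cremona11907s2Tw.tamagawaProduct = padicValNat 3 cremona11907s2.tamagawaProduct)
    (hμ : ¬ 3 ∣ Units.torsionOrder K) (hr : cremona11907s1.analyticRank = 1) :
    (cremona11907s2.mordellWeilRank = 1 ∧ BSDp cremona11907s2 3) ∧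
      (cremona11907s1.analyticRank = 1 ∧ BSDp cremona11907s1 3) :=
  haveI : NeZero (11907 : ℕ) := ⟨by norm_num⟩
  bsdp_three_transport (21) (-47) 11907 cremona11907s1 cremona11907s2 cremona11907s2Tw K Dt H ι P h hGZ hKo
    hCM0 hmod hCassels isIsogenous_cremona11907s cremona11907s2_eq hN hK hD (by simpa using hH) hHN hP
    (Or.inl ⟨by norm_num, by exact_mod_cast Int.squarefree_natCast.mpr ((show (21 : ℕ) = 3 * 7 by norm_num) ▸
      (Nat.squarefree_mul (by norm_num)).mpr ⟨(Nat.prime_iff.mp Nat.prime_three).squarefree,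
        (Nat.prime_iff.mp (by norm_num : Nat.Prime 7)).squarefree⟩), by norm_num⟩) (by norm_num)
    (fun _ => ⟨by norm_num; exact h3a, by norm_num; exact h3b⟩) (fun h => absurd h (by norm_num))
    h4 hr shiftHalfT cremona11907s2_twist htam padicValRat_shiftHalfT_u hμ

/-- **15129a** (`d = 41`, `N = 15129 = 3²·41²`, `K = ℚ(√-8)`): `rank = 1 ∧ BSD(15129a2, 3)` and
`r_an = 1 ∧ BSD(15129a1, 3)` from the published facts, the Gross–Zagier data of the pair, the
arithmetic inputs `N(15129a2) = 15129`, `h₃(-123) = h₃(-328) = 1`, `ord₃ Tam([0,0,0,0,2214]) = ord₃ Tam(15129a2)`,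
`3 ∤ #μ(K)`, and the census datum `r_an(15129a1) = 1`; minimality, isogeny, `15129a2 ≅ E_d`, the
twist model with `ord₃ u = 0`, hypotheses (1), (2) discharged in the kernel.
[cite: KrizLi2019, Thm. 1.23 = Thm. 10.10] [cite: Cremona1997, Table 1 (class 15129a)] -/
theorem bsdp_three_cremona15129a (K : Type) [Field K] [NumberField K]
    (Dt : ModularParametrizationData cremona15129a2 15129) (H : HeegnerDatum 15129 (NumberField.discr K))
    (ι : K →+* ℂ) (P : (cremona15129a2.baseChange K).toAffine.Point)
    (h : thm1010_bsdThree_overK_sexticTwist) (hGZ : gross_zagier 15129 cremona15129a2 K)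
    (hKo : kolyvagin 15129 cremona15129a2 K) (hCM0 : bsdTriple_of_hasCM_of_L_one_ne_zero)
    (hmod : hasEntireLFunction_rat) (hCassels : bsdRHS_eq_of_isIsogenous)
    (hK : IsImaginaryQuadratic K) (hD : NumberField.discr K = -8)
    (hH : SatisfiesHeegnerHypothesis 123 K) (hHN : SatisfiesHeegnerHypothesis 15129 K)
    (hP : WeierstrassCurve.Affine.Point.map ι.toRatAlgHom P = heegnerPointComplex Dt H)
    (h4 : ¬ (3 : ℤ) ∣ Dt.c) (hN : cremona15129a2.conductorNorm ℤ = 15129)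
    (h3a : ThreeClassNumberTrivial (-123)) (h3b : ThreeClassNumberTrivial (-328))
    (htam : padicValNat 3 cremona15129a2Tw.tamagawaProduct = padicValNat 3 cremona15129a2.tamagawaProduct)
    (hμ : ¬ 3 ∣ Units.torsionOrder K) (hr : cremona15129a1.analyticRank = 1) :
    (cremona15129a2.mordellWeilRank = 1 ∧ BSDp cremona15129a2 3) ∧
      (cremona15129a1.analyticRank = 1 ∧ BSDp cremona15129a1 3) :=
  haveI : NeZero (15129 : ℕ) := ⟨by norm_num⟩
  bsdp_three_transport (41) (-8) 15129 cremona15129a1 cremona15129a2 cremona15129a2Tw K Dt H ι P h hGZ hKo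
    hCM0 hmod hCassels isIsogenous_cremona15129a cremona15129a2_eq hN hK hD (by simpa using hH) hHN hP
    (Or.inl ⟨by norm_num, by exact_mod_cast squarefree_intCast_of_prime (by norm_num : Nat.Prime 41),
      by norm_num⟩) (by norm_num)
    (fun _ => ⟨by norm_num; exact h3a, by norm_num; exact h3b⟩) (fun h => absurd h (by norm_num))
    h4 hr scaleTwo cremona15129a2_twist htam padicValRat_scaleTwo_u hμ

/-! ### §7. Side condition (iii) discharged: `3 ∣ #μ(K)` only for `K = ℚ(√−3)` -/

section TorsionThree

variable {K : Type*} [Field K] [NumberField K]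

/-- **A quadratic field with a unit of order `3` is `ℚ(√−3)`**: if `[K : ℚ] = 2` and
`3 ∣ #μ(K)` (`NumberField.Units.torsionOrder`), then `d_K = −3`. A unit `u` of order `3`
(Cauchy, `exists_prime_orderOf_dvd_card'` in the cyclic group `μ(K)`) gives `x = u ∈ K` with
`x³ = 1`, `x ≠ 1`, so `x² + x + 1 = 0` and `(2x + 1)² = −3`; hence `d_K = −3·q²`
(`NumberField.exists_discr_eq_mul_sq`), and two fundamental discriminants differing by a rational
square are equal (`Quadratic.eq_of_isFundamental_of_eq_mul_sq`). Cox, *Primes of the form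
x² + ny²*, §7.A / Lemma 7.2 (`𝒪^× = {±1}` unless `d_K ∈ {−3, −4}`). [cite: Cox2013, §7.A] -/
theorem discr_eq_neg_three_of_three_dvd_torsionOrder (h2 : Module.finrank ℚ K = 2)
    (h3 : 3 ∣ NumberField.Units.torsionOrder K) : NumberField.discr K = -3 := by
  haveI : Fact (Nat.Prime 3) := ⟨Nat.prime_three⟩
  obtain ⟨ζ, hζ⟩ := exists_prime_orderOf_dvd_card' (G := NumberField.Units.torsion K) 3 h3
  -- the unit and its image in `K`
  set u : (𝓞 K)ˣ := (ζ : (𝓞 K)ˣ) with hu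
  have hu3 : orderOf u = 3 := by rw [hu, Subgroup.orderOf_coe, hζ]
  set x : K := ((u : 𝓞 K) : K) with hx
  have hx3 : x ^ 3 = 1 := by
    have h1 : u ^ 3 = 1 := by rw [← hu3]; exact pow_orderOf_eq_one u
    have h2' : ((u ^ 3 : (𝓞 K)ˣ) : 𝓞 K) = 1 := by rw [h1]; rfl
    rw [Units.val_pow_eq_pow_val] at h2'
    have h3' := congrArg (algebraMap (𝓞 K) K) h2'
    rw [map_pow, map_one] at h3'
    exact h3'
  have hx1 : x ≠ 1 := by
    intro h
    have h' : (u : 𝓞 K) = 1 := by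
      apply IsFractionRing.injective (𝓞 K) K
      rw [map_one]
      exact h
    have hu1 : u = 1 := Units.ext h'
    rw [hu1, orderOf_one] at hu3
    exact absurd hu3 (by norm_num)
  have hrel : x ^ 2 + x + 1 = 0 := by
    have hfac : (x - 1) * (x ^ 2 + x + 1) = 0 := by
      have : (x - 1) * (x ^ 2 + x + 1) = x ^ 3 - 1 := by ring
      rw [this, hx3, sub_self]
    rcases mul_eq_zero.mp hfac with h | h
    · exact absurd (sub_eq_zero.mp h) hx1
    · exact h
  -- `θ = 2x + 1` has `θ² = −3` and is irrational
  set θ : K := 2 * x + 1 with hθ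
  have hc : θ ^ 2 = algebraMap ℚ K (-3) := by
    rw [map_neg, map_ofNat, hθ]
    linear_combination (4 : K) * hrel
  have hθrat : θ ∉ Set.range (algebraMap ℚ K) := by
    rintro ⟨q, hq⟩
    have hq2 : algebraMap ℚ K (q ^ 2) = algebraMap ℚ K (-3) := by rw [map_pow, hq, hc]
    have hq3 : q ^ 2 = -3 := (algebraMap ℚ K).injective hq2
    nlinarith [sq_nonneg q]
  obtain ⟨q, -, hq⟩ := NumberField.exists_discr_eq_mul_sq h2 hθrat hc
  have hfund3 : ((-3 : ℤ) % 4 = 1 ∧ Squarefree (-3 : ℤ) ∧ (-3 : ℤ) ≠ 1) ∨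
      (4 ∣ (-3 : ℤ) ∧ ((-3 : ℤ) / 4 % 4 = 2 ∨ (-3 : ℤ) / 4 % 4 = 3) ∧ Squarefree ((-3 : ℤ) / 4)) :=
    Or.inl ⟨by norm_num, Int.squarefree_natAbs.mp
      (by simpa using (Nat.prime_iff.mp Nat.prime_three).squarefree), by norm_num⟩
  exact Literature.NumberTheory.QuadraticFields.Quadratic.eq_of_isFundamental_of_eq_mul_sq
    (Literature.NumberTheory.QuadraticFields.Quadratic.isFundamentalDiscriminant_discr h2) hfund3
    (q := q) (by rw [hq]; push_cast; ring)

/-- Hence `3 ∤ #μ(K)` for a quadratic field with `d_K ≠ −3`: side condition (iii) of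
`KrizLi2019.bsdp_three_of_thm1010` holds for every admissible `K` of the seven classes.
[cite: Cox2013, §7.A] -/
theorem not_three_dvd_torsionOrder (h2 : Module.finrank ℚ K = 2) (hD : NumberField.discr K ≠ -3) :
    ¬ 3 ∣ NumberField.Units.torsionOrder K :=
  fun h3 ↦ hD (discr_eq_neg_three_of_three_dvd_torsionOrder h2 h3)

end TorsionThree

/-- **Generic transport, side condition (iii) discharged**: as `bsdp_three_transport`, with the
hypothesis `3 ∤ #μ(K)` replaced by `D ≠ −3` (`not_three_dvd_torsionOrder`).
[cite: KrizLi2019, Thm. 1.23 = Thm. 10.10] [cite: Cox2013, §7.A] -/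
theorem bsdp_three_transport' (d D : ℤ) (N : ℕ) [NeZero N] (W₁ W₂ Wd : WeierstrassCurve ℚ)
    [W₁.IsElliptic] [W₁.IsGloballyMinimal] [W₂.IsElliptic] [W₂.IsGloballyMinimal]
    [Wd.IsElliptic] [Wd.IsGloballyMinimal]
    (K : Type) [Field K] [NumberField K]
    (Dt : ModularParametrizationData W₂ N) (H : HeegnerDatum N (NumberField.discr K)) (ι : K →+* ℂ)
    (P : (W₂.baseChange K).toAffine.Point)
    (h : thm1010_bsdThree_overK_sexticTwist) (hGZ : gross_zagier N W₂ K) (hKo : kolyvagin N W₂ K)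
    (hCM0 : bsdTriple_of_hasCM_of_L_one_ne_zero) (hmod : hasEntireLFunction_rat)
    (hCassels : bsdRHS_eq_of_isIsogenous)
    (hiso : IsIsogenous W₁ W₂)
    (hW : ∃ C : VariableChange ℚ, C • W₂ = ({ a₁ := 0, a₂ := 0, a₃ := 0, a₄ := 0, a₆ := -432 * d } :
      WeierstrassCurve ℚ))
    (hN : W₂.conductorNorm ℤ = N) (hK : IsImaginaryQuadratic K) (hD : NumberField.discr K = D)
    (hD3 : D ≠ -3)
    (hH : SatisfiesHeegnerHypothesis (3 * d.natAbs) K) (hHN : SatisfiesHeegnerHypothesis N K)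
    (hP : WeierstrassCurve.Affine.Point.map ι.toRatAlgHom P = heegnerPointComplex Dt H)
    (h1 : (d % 4 = 1 ∧ Squarefree d ∧ d ≠ 1) ∨
      (4 ∣ d ∧ (d / 4 % 4 = 2 ∨ d / 4 % 4 = 3) ∧ Squarefree (d / 4)))
    (h9 : d % 9 = 2 ∨ d % 9 = 3 ∨ d % 9 = 5 ∨ d % 9 = 8)
    (h3pos : 0 < d → ThreeClassNumberTrivial (-3 * d) ∧ ThreeClassNumberTrivial (D * d))
    (h3neg : d < 0 → ThreeClassNumberTrivial d ∧ ThreeClassNumberTrivial (-3 * D * d))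
    (h4 : ¬ (3 : ℤ) ∣ Dt.c) (hr : W₁.analyticRank = 1)
    (Cd : VariableChange ℚ) (hWd : Cd • W₂.quadraticTwist ((D : ℤ) : ℚ) = Wd)
    (htam : padicValNat 3 Wd.tamagawaProduct = padicValNat 3 W₂.tamagawaProduct)
    (hu : padicValRat 3 (Cd.u : ℚ) = 0) :
    (W₂.mordellWeilRank = 1 ∧ BSDp W₂ 3) ∧ (W₁.analyticRank = 1 ∧ BSDp W₁ 3) :=
  bsdp_three_transport d D N W₁ W₂ Wd K Dt H ι P h hGZ hKo hCM0 hmod hCassels hiso hW hN hK hD hH hHN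
    hP h1 h9 h3pos h3neg h4 hr Cd hWd htam hu
    (not_three_dvd_torsionOrder hK.1 (by rw [hD]; exact hD3))

/-! ### §8. The seven census records without the `#μ(K)` hypothesis -/

/-- **225a**, final form: as `bsdp_three_cremona225a` but WITHOUT the hypothesis `3 ∤ #μ(K)`
(discharged: `d_K = -11 ≠ −3`). Remaining hypotheses: the published facts, the Gross–Zagier
data (`K` with `d_K = -11`, Heegner for `15` and `225`, `Dt` with `3 ∤ c`, `P`), the
arithmetic inputs `N(225a2) = 225`, `h₃(-15) = h₃(-55) = 1`, side condition (i), and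
`r_an(225a1) = 1`. [cite: KrizLi2019, Thm. 1.23 = Thm. 10.10] [cite: Cremona1997, Table 1 (class 225a)] -/
theorem bsdp_three_cremona225a' (K : Type) [Field K] [NumberField K]
    (Dt : ModularParametrizationData cremona225a2 225) (H : HeegnerDatum 225 (NumberField.discr K))
    (ι : K →+* ℂ) (P : (cremona225a2.baseChange K).toAffine.Point)
    (h : thm1010_bsdThree_overK_sexticTwist) (hGZ : gross_zagier 225 cremona225a2 K)
    (hKo : kolyvagin 225 cremona225a2 K) (hCM0 : bsdTriple_of_hasCM_of_L_one_ne_zero)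
    (hmod : hasEntireLFunction_rat) (hCassels : bsdRHS_eq_of_isIsogenous)
    (hK : IsImaginaryQuadratic K) (hD : NumberField.discr K = -11)
    (hH : SatisfiesHeegnerHypothesis 15 K) (hHN : SatisfiesHeegnerHypothesis 225 K)
    (hP : WeierstrassCurve.Affine.Point.map ι.toRatAlgHom P = heegnerPointComplex Dt H)
    (h4 : ¬ (3 : ℤ) ∣ Dt.c) (hN : cremona225a2.conductorNorm ℤ = 225)
    (h3a : ThreeClassNumberTrivial (-15)) (h3b : ThreeClassNumberTrivial (-55))
    (htam : padicValNat 3 cremona225a2Tw.tamagawaProduct = padicValNat 3 cremona225a2.tamagawaProduct)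
    (hr : cremona225a1.analyticRank = 1) :
    (cremona225a2.mordellWeilRank = 1 ∧ BSDp cremona225a2 3) ∧
      (cremona225a1.analyticRank = 1 ∧ BSDp cremona225a1 3) :=
  haveI : NeZero (225 : ℕ) := ⟨by norm_num⟩
  bsdp_three_transport' (5) (-11) 225 cremona225a1 cremona225a2 cremona225a2Tw K Dt H ι P h hGZ hKo
    hCM0 hmod hCassels isIsogenous_cremona225a cremona225a2_eq hN hK hD (by norm_num)
    (by simpa using hH) hHN hP
    (Or.inl ⟨by norm_num, by exact_mod_cast squarefree_intCast_of_prime (by norm_num : Nat.Prime 5),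
      by norm_num⟩) (by norm_num)
    (fun _ => ⟨by norm_num; exact h3a, by norm_num; exact h3b⟩) (fun h => absurd h (by norm_num))
    h4 hr shiftHalfT cremona225a2_twist htam padicValRat_shiftHalfT_u

/-- **1323m**, final form: as `bsdp_three_cremona1323m` but WITHOUT the hypothesis `3 ∤ #μ(K)`
(discharged: `d_K = -47 ≠ −3`). Remaining hypotheses: the published facts, the Gross–Zagier
data (`K` with `d_K = -47`, Heegner for `21` and `1323`, `Dt` with `3 ∤ c`, `P`), the
arithmetic inputs `N(1323m2) = 1323`, `h₃(-7) = h₃(-987) = 1`, side condition (i), and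
`r_an(1323m1) = 1`. [cite: KrizLi2019, Thm. 1.23 = Thm. 10.10] [cite: Cremona1997, Table 1 (class 1323m)] -/
theorem bsdp_three_cremona1323m' (K : Type) [Field K] [NumberField K]
    (Dt : ModularParametrizationData cremona1323m2 1323) (H : HeegnerDatum 1323 (NumberField.discr K))
    (ι : K →+* ℂ) (P : (cremona1323m2.baseChange K).toAffine.Point)
    (h : thm1010_bsdThree_overK_sexticTwist) (hGZ : gross_zagier 1323 cremona1323m2 K)
    (hKo : kolyvagin 1323 cremona1323m2 K) (hCM0 : bsdTriple_of_hasCM_of_L_one_ne_zero)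
    (hmod : hasEntireLFunction_rat) (hCassels : bsdRHS_eq_of_isIsogenous)
    (hK : IsImaginaryQuadratic K) (hD : NumberField.discr K = -47)
    (hH : SatisfiesHeegnerHypothesis 21 K) (hHN : SatisfiesHeegnerHypothesis 1323 K)
    (hP : WeierstrassCurve.Affine.Point.map ι.toRatAlgHom P = heegnerPointComplex Dt H)
    (h4 : ¬ (3 : ℤ) ∣ Dt.c) (hN : cremona1323m2.conductorNorm ℤ = 1323)
    (h3a : ThreeClassNumberTrivial (-7)) (h3b : ThreeClassNumberTrivial (-987))
    (htam : padicValNat 3 cremona1323m2Tw.tamagawaProduct = padicValNat 3 cremona1323m2.tamagawaProduct)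
    (hr : cremona1323m1.analyticRank = 1) :
    (cremona1323m2.mordellWeilRank = 1 ∧ BSDp cremona1323m2 3) ∧
      (cremona1323m1.analyticRank = 1 ∧ BSDp cremona1323m1 3) :=
  haveI : NeZero (1323 : ℕ) := ⟨by norm_num⟩
  bsdp_three_transport' (-7) (-47) 1323 cremona1323m1 cremona1323m2 cremona1323m2Tw K Dt H ι P h hGZ hKo
    hCM0 hmod hCassels isIsogenous_cremona1323m cremona1323m2_eq hN hK hD (by norm_num)
    (by simpa using hH) hHN hP
    (Or.inl ⟨by norm_num, Int.squarefree_natAbs.mp (by simpa using (Nat.prime_iff.mp (by norm_num : Nat.Prime 7)).squarefree),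
      by norm_num⟩) (by norm_num)
    (fun h => absurd h (by norm_num)) (fun _ => ⟨h3a, by norm_num; exact h3b⟩)
    h4 hr shiftHalfT cremona1323m2_twist htam padicValRat_shiftHalfT_u

/-- **1728a**, final form: as `bsdp_three_cremona1728a` but WITHOUT the hypothesis `3 ∤ #μ(K)`
(discharged: `d_K = -23 ≠ −3`). Remaining hypotheses: the published facts, the Gross–Zagier
data (`K` with `d_K = -23`, Heegner for `24` and `1728`, `Dt` with `3 ∤ c`, `P`), the
arithmetic inputs `N(1728a2) = 1728`, `h₃(-24) = h₃(-184) = 1`, side condition (i), and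
`r_an(1728a1) = 1`. [cite: KrizLi2019, Thm. 1.23 = Thm. 10.10] [cite: Cremona1997, Table 1 (class 1728a)] -/
theorem bsdp_three_cremona1728a' (K : Type) [Field K] [NumberField K]
    (Dt : ModularParametrizationData cremona1728a2 1728) (H : HeegnerDatum 1728 (NumberField.discr K))
    (ι : K →+* ℂ) (P : (cremona1728a2.baseChange K).toAffine.Point)
    (h : thm1010_bsdThree_overK_sexticTwist) (hGZ : gross_zagier 1728 cremona1728a2 K)
    (hKo : kolyvagin 1728 cremona1728a2 K) (hCM0 : bsdTriple_of_hasCM_of_L_one_ne_zero)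
    (hmod : hasEntireLFunction_rat) (hCassels : bsdRHS_eq_of_isIsogenous)
    (hK : IsImaginaryQuadratic K) (hD : NumberField.discr K = -23)
    (hH : SatisfiesHeegnerHypothesis 24 K) (hHN : SatisfiesHeegnerHypothesis 1728 K)
    (hP : WeierstrassCurve.Affine.Point.map ι.toRatAlgHom P = heegnerPointComplex Dt H)
    (h4 : ¬ (3 : ℤ) ∣ Dt.c) (hN : cremona1728a2.conductorNorm ℤ = 1728)
    (h3a : ThreeClassNumberTrivial (-24)) (h3b : ThreeClassNumberTrivial (-184))
    (htam : padicValNat 3 cremona1728a2Tw.tamagawaProduct = padicValNat 3 cremona1728a2.tamagawaProduct)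
    (hr : cremona1728a1.analyticRank = 1) :
    (cremona1728a2.mordellWeilRank = 1 ∧ BSDp cremona1728a2 3) ∧
      (cremona1728a1.analyticRank = 1 ∧ BSDp cremona1728a1 3) :=
  haveI : NeZero (1728 : ℕ) := ⟨by norm_num⟩
  bsdp_three_transport' (8) (-23) 1728 cremona1728a1 cremona1728a2 cremona1728a2Tw K Dt H ι P h hGZ hKo
    hCM0 hmod hCassels isIsogenous_cremona1728a cremona1728a2_eq hN hK hD (by norm_num)
    (by simpa using hH) hHN hP
    (Or.inr ⟨by norm_num, Or.inl (by norm_num),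
      by rw [show (8 : ℤ) / 4 = 2 by norm_num]; exact_mod_cast squarefree_intCast_of_prime Nat.prime_two⟩) (by norm_num)
    (fun _ => ⟨by norm_num; exact h3a, by norm_num; exact h3b⟩) (fun h => absurd h (by norm_num))
    h4 hr (1 : VariableChange ℚ) cremona1728a2_twist htam padicValRat_one_u

/-- **3888t**, final form: as `bsdp_three_cremona3888t` but WITHOUT the hypothesis `3 ∤ #μ(K)`
(discharged: `d_K = -23 ≠ −3`). Remaining hypotheses: the published facts, the Gross–Zagier
data (`K` with `d_K = -23`, Heegner for `36` and `3888`, `Dt` with `3 ∤ c`, `P`), the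
arithmetic inputs `N(3888t2) = 3888`, `h₃(-36) = h₃(-276) = 1`, side condition (i), and
`r_an(3888t1) = 1`. [cite: KrizLi2019, Thm. 1.23 = Thm. 10.10] [cite: Cremona1997, Table 1 (class 3888t)] -/
theorem bsdp_three_cremona3888t' (K : Type) [Field K] [NumberField K]
    (Dt : ModularParametrizationData cremona3888t2 3888) (H : HeegnerDatum 3888 (NumberField.discr K))
    (ι : K →+* ℂ) (P : (cremona3888t2.baseChange K).toAffine.Point)
    (h : thm1010_bsdThree_overK_sexticTwist) (hGZ : gross_zagier 3888 cremona3888t2 K)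
    (hKo : kolyvagin 3888 cremona3888t2 K) (hCM0 : bsdTriple_of_hasCM_of_L_one_ne_zero)
    (hmod : hasEntireLFunction_rat) (hCassels : bsdRHS_eq_of_isIsogenous)
    (hK : IsImaginaryQuadratic K) (hD : NumberField.discr K = -23)
    (hH : SatisfiesHeegnerHypothesis 36 K) (hHN : SatisfiesHeegnerHypothesis 3888 K)
    (hP : WeierstrassCurve.Affine.Point.map ι.toRatAlgHom P = heegnerPointComplex Dt H)
    (h4 : ¬ (3 : ℤ) ∣ Dt.c) (hN : cremona3888t2.conductorNorm ℤ = 3888)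
    (h3a : ThreeClassNumberTrivial (-36)) (h3b : ThreeClassNumberTrivial (-276))
    (htam : padicValNat 3 cremona3888t2Tw.tamagawaProduct = padicValNat 3 cremona3888t2.tamagawaProduct)
    (hr : cremona3888t1.analyticRank = 1) :
    (cremona3888t2.mordellWeilRank = 1 ∧ BSDp cremona3888t2 3) ∧
      (cremona3888t1.analyticRank = 1 ∧ BSDp cremona3888t1 3) :=
  haveI : NeZero (3888 : ℕ) := ⟨by norm_num⟩
  bsdp_three_transport' (12) (-23) 3888 cremona3888t1 cremona3888t2 cremona3888t2Tw K Dt H ι P h hGZ hKo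
    hCM0 hmod hCassels isIsogenous_cremona3888t cremona3888t2_eq hN hK hD (by norm_num)
    (by simpa using hH) hHN hP
    (Or.inr ⟨by norm_num, Or.inr (by norm_num),
      by rw [show (12 : ℤ) / 4 = 3 by norm_num]; exact_mod_cast squarefree_intCast_of_prime Nat.prime_three⟩) (by norm_num)
    (fun _ => ⟨by norm_num; exact h3a, by norm_num; exact h3b⟩) (fun h => absurd h (by norm_num))
    h4 hr (1 : VariableChange ℚ) cremona3888t2_twist htam padicValRat_one_u

/-- **7803b**, final form: as `bsdp_three_cremona7803b` but WITHOUT the hypothesis `3 ∤ #μ(K)`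
(discharged: `d_K = -8 ≠ −3`). Remaining hypotheses: the published facts, the Gross–Zagier
data (`K` with `d_K = -8`, Heegner for `51` and `7803`, `Dt` with `3 ∤ c`, `P`), the
arithmetic inputs `N(7803b2) = 7803`, `h₃(-51) = h₃(-136) = 1`, side condition (i), and
`r_an(7803b1) = 1`. [cite: KrizLi2019, Thm. 1.23 = Thm. 10.10] [cite: Cremona1997, Table 1 (class 7803b)] -/
theorem bsdp_three_cremona7803b' (K : Type) [Field K] [NumberField K]
    (Dt : ModularParametrizationData cremona7803b2 7803) (H : HeegnerDatum 7803 (NumberField.discr K))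
    (ι : K →+* ℂ) (P : (cremona7803b2.baseChange K).toAffine.Point)
    (h : thm1010_bsdThree_overK_sexticTwist) (hGZ : gross_zagier 7803 cremona7803b2 K)
    (hKo : kolyvagin 7803 cremona7803b2 K) (hCM0 : bsdTriple_of_hasCM_of_L_one_ne_zero)
    (hmod : hasEntireLFunction_rat) (hCassels : bsdRHS_eq_of_isIsogenous)
    (hK : IsImaginaryQuadratic K) (hD : NumberField.discr K = -8)
    (hH : SatisfiesHeegnerHypothesis 51 K) (hHN : SatisfiesHeegnerHypothesis 7803 K)
    (hP : WeierstrassCurve.Affine.Point.map ι.toRatAlgHom P = heegnerPointComplex Dt H)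
    (h4 : ¬ (3 : ℤ) ∣ Dt.c) (hN : cremona7803b2.conductorNorm ℤ = 7803)
    (h3a : ThreeClassNumberTrivial (-51)) (h3b : ThreeClassNumberTrivial (-136))
    (htam : padicValNat 3 cremona7803b2Tw.tamagawaProduct = padicValNat 3 cremona7803b2.tamagawaProduct)
    (hr : cremona7803b1.analyticRank = 1) :
    (cremona7803b2.mordellWeilRank = 1 ∧ BSDp cremona7803b2 3) ∧
      (cremona7803b1.analyticRank = 1 ∧ BSDp cremona7803b1 3) :=
  haveI : NeZero (7803 : ℕ) := ⟨by norm_num⟩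
  bsdp_three_transport' (17) (-8) 7803 cremona7803b1 cremona7803b2 cremona7803b2Tw K Dt H ι P h hGZ hKo
    hCM0 hmod hCassels isIsogenous_cremona7803b cremona7803b2_eq hN hK hD (by norm_num)
    (by simpa using hH) hHN hP
    (Or.inl ⟨by norm_num, by exact_mod_cast squarefree_intCast_of_prime (by norm_num : Nat.Prime 17),
      by norm_num⟩) (by norm_num)
    (fun _ => ⟨by norm_num; exact h3a, by norm_num; exact h3b⟩) (fun h => absurd h (by norm_num))
    h4 hr scaleTwo cremona7803b2_twist htam padicValRat_scaleTwo_u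

/-- **11907s**, final form: as `bsdp_three_cremona11907s` but WITHOUT the hypothesis `3 ∤ #μ(K)`
(discharged: `d_K = -47 ≠ −3`). Remaining hypotheses: the published facts, the Gross–Zagier
data (`K` with `d_K = -47`, Heegner for `63` and `11907`, `Dt` with `3 ∤ c`, `P`), the
arithmetic inputs `N(11907s2) = 11907`, `h₃(-63) = h₃(-987) = 1`, side condition (i), and
`r_an(11907s1) = 1`. [cite: KrizLi2019, Thm. 1.23 = Thm. 10.10] [cite: Cremona1997, Table 1 (class 11907s)] -/
theorem bsdp_three_cremona11907s' (K : Type) [Field K] [NumberField K]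
    (Dt : ModularParametrizationData cremona11907s2 11907) (H : HeegnerDatum 11907 (NumberField.discr K))
    (ι : K →+* ℂ) (P : (cremona11907s2.baseChange K).toAffine.Point)
    (h : thm1010_bsdThree_overK_sexticTwist) (hGZ : gross_zagier 11907 cremona11907s2 K)
    (hKo : kolyvagin 11907 cremona11907s2 K) (hCM0 : bsdTriple_of_hasCM_of_L_one_ne_zero)
    (hmod : hasEntireLFunction_rat) (hCassels : bsdRHS_eq_of_isIsogenous)
    (hK : IsImaginaryQuadratic K) (hD : NumberField.discr K = -47)
    (hH : SatisfiesHeegnerHypothesis 63 K) (hHN : SatisfiesHeegnerHypothesis 11907 K)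
    (hP : WeierstrassCurve.Affine.Point.map ι.toRatAlgHom P = heegnerPointComplex Dt H)
    (h4 : ¬ (3 : ℤ) ∣ Dt.c) (hN : cremona11907s2.conductorNorm ℤ = 11907)
    (h3a : ThreeClassNumberTrivial (-63)) (h3b : ThreeClassNumberTrivial (-987))
    (htam : padicValNat 3 cremona11907s2Tw.tamagawaProduct = padicValNat 3 cremona11907s2.tamagawaProduct)
    (hr : cremona11907s1.analyticRank = 1) :
    (cremona11907s2.mordellWeilRank = 1 ∧ BSDp cremona11907s2 3) ∧
      (cremona11907s1.analyticRank = 1 ∧ BSDp cremona11907s1 3) :=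
  haveI : NeZero (11907 : ℕ) := ⟨by norm_num⟩
  bsdp_three_transport' (21) (-47) 11907 cremona11907s1 cremona11907s2 cremona11907s2Tw K Dt H ι P h hGZ hKo
    hCM0 hmod hCassels isIsogenous_cremona11907s cremona11907s2_eq hN hK hD (by norm_num)
    (by simpa using hH) hHN hP
    (Or.inl ⟨by norm_num, by exact_mod_cast Int.squarefree_natCast.mpr ((show (21 : ℕ) = 3 * 7 by norm_num) ▸
      (Nat.squarefree_mul (by norm_num)).mpr ⟨(Nat.prime_iff.mp Nat.prime_three).squarefree,
        (Nat.prime_iff.mp (by norm_num : Nat.Prime 7)).squarefree⟩), by norm_num⟩) (by norm_num)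
    (fun _ => ⟨by norm_num; exact h3a, by norm_num; exact h3b⟩) (fun h => absurd h (by norm_num))
    h4 hr shiftHalfT cremona11907s2_twist htam padicValRat_shiftHalfT_u

/-- **15129a**, final form: as `bsdp_three_cremona15129a` but WITHOUT the hypothesis `3 ∤ #μ(K)`
(discharged: `d_K = -8 ≠ −3`). Remaining hypotheses: the published facts, the Gross–Zagier
data (`K` with `d_K = -8`, Heegner for `123` and `15129`, `Dt` with `3 ∤ c`, `P`), the
arithmetic inputs `N(15129a2) = 15129`, `h₃(-123) = h₃(-328) = 1`, side condition (i), and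
`r_an(15129a1) = 1`. [cite: KrizLi2019, Thm. 1.23 = Thm. 10.10] [cite: Cremona1997, Table 1 (class 15129a)] -/
theorem bsdp_three_cremona15129a' (K : Type) [Field K] [NumberField K]
    (Dt : ModularParametrizationData cremona15129a2 15129) (H : HeegnerDatum 15129 (NumberField.discr K))
    (ι : K →+* ℂ) (P : (cremona15129a2.baseChange K).toAffine.Point)
    (h : thm1010_bsdThree_overK_sexticTwist) (hGZ : gross_zagier 15129 cremona15129a2 K)
    (hKo : kolyvagin 15129 cremona15129a2 K) (hCM0 : bsdTriple_of_hasCM_of_L_one_ne_zero)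
    (hmod : hasEntireLFunction_rat) (hCassels : bsdRHS_eq_of_isIsogenous)
    (hK : IsImaginaryQuadratic K) (hD : NumberField.discr K = -8)
    (hH : SatisfiesHeegnerHypothesis 123 K) (hHN : SatisfiesHeegnerHypothesis 15129 K)
    (hP : WeierstrassCurve.Affine.Point.map ι.toRatAlgHom P = heegnerPointComplex Dt H)
    (h4 : ¬ (3 : ℤ) ∣ Dt.c) (hN : cremona15129a2.conductorNorm ℤ = 15129)
    (h3a : ThreeClassNumberTrivial (-123)) (h3b : ThreeClassNumberTrivial (-328))
    (htam : padicValNat 3 cremona15129a2Tw.tamagawaProduct = padicValNat 3 cremona15129a2.tamagawaProduct)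
    (hr : cremona15129a1.analyticRank = 1) :
    (cremona15129a2.mordellWeilRank = 1 ∧ BSDp cremona15129a2 3) ∧
      (cremona15129a1.analyticRank = 1 ∧ BSDp cremona15129a1 3) :=
  haveI : NeZero (15129 : ℕ) := ⟨by norm_num⟩
  bsdp_three_transport' (41) (-8) 15129 cremona15129a1 cremona15129a2 cremona15129a2Tw K Dt H ι P h hGZ hKo
    hCM0 hmod hCassels isIsogenous_cremona15129a cremona15129a2_eq hN hK hD (by norm_num)
    (by simpa using hH) hHN hP
    (Or.inl ⟨by norm_num, by exact_mod_cast squarefree_intCast_of_prime (by norm_num : Nat.Prime 41),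
      by norm_num⟩) (by norm_num)
    (fun _ => ⟨by norm_num; exact h3a, by norm_num; exact h3b⟩) (fun h => absurd h (by norm_num))
    h4 hr scaleTwo cremona15129a2_twist htam padicValRat_scaleTwo_u

end Literature.NumberTheory.EllipticCurves.Rank1Residual.X12SexticTwist

end
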